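import Literature.NumberTheory.EllipticCurves.ModularFormsGamma0Rank
import Literature.NumberTheory.EllipticCurves.PAdicLFunctionDistributionProofs
import Mathlib.NumberTheory.ModularForms.CuspFormSubmodule
import Mathlib.GroupTheory.GroupAction.Period
import Mathlib.Data.ZMod.QuotientGroup
import HarnessLib

/-!
# The cusp order of `𝒟`, `dim S₂(Γ₀(N)) = g(X₀(N))` for every `N`, and `Ω^±_f > 0`
  (trunk EllArithM, item C17; third and last file of the elementary free-module route, after
  `ModularFormsGamma0FreeModule` and `ModularFormsGamma0Rank`)

With a level-one basis `F_1, …, F_μ` of `M(Γ₀(N))` over `ℂ[E₄, E₆]` of even weights `k_j ≥ 0`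
(`exists_isLevelOneBasis_card_eq`) and the determinant `𝒟 = det (F_j ∣ γ_a)` of
`ModularFormsGamma0Rank` (`𝒟¹² = cΔ^K`, `c ≠ 0`, `K = ∑ k_j`), this file proves the last of
Gannon's constraints, the **cusp count `∑ k_j = 6(μ - ν_∞)`** (`totalWeight_eq`; Gannon 2014
Thm. 3.4(b): `∑ w = 12 Tr λ`, `Tr λ = ∑_cusps ∑_{s<w} s/w = (μ - ν_∞)/2` for `ρ = Ind 1`), and then
assembles the dimension formula:

* `twelve_mul_genusX0_add_le_card_wt_two`: the four constraints and `12g = 12 + μ - 3ν₂ - 4ν₃ - 6ν_∞`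
  (`twelve_mul_genusX0_holds`) give `dim M₂(Γ₀(N)) = #{j : k_j = 2} ≥ g - 1 + ν_∞` by summing the
  elementary inequality `6[k ≢ 0 (4)] + 8[k ≡ 2 (6)] + 4[k ≡ 4 (6)] ≤ k + 12[k = 2]` over the
  generators (`weight_ineq`, `finrank_gamma0Space_two`);
* `finrank_gamma0Space_two_le`: **`dim S₂(Γ₀(N)) ≥ dim M₂(Γ₀(N)) - ν_∞ + 1`** by the residue
  relation: the trace `∑_x f ∣ x` of `f ∈ M₂(Γ₀(N))` over `SL₂(ℤ)/Γ₀(N)` lies in `M₂(SL₂(ℤ)) = 0`,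
  so the values of `f` at the cusps satisfy `∑_cusps w_c · v_c(f) = 0` (`sum_width_mul_valueAtInfty_eq_zero`);
  the cusp-value map `M₂(Γ₀(N)) → ℂ^{cusps}` therefore has rank `≤ ν_∞ - 1`, and its kernel consists
  of cusp forms (`kerToCuspForm`, Mathlib's `OnePoint.isZeroAt_iff_forall_SL2Z`);
* `genusX0_le_finrank_cuspForm_two`: **`g(X₀(N)) ≤ dim S₂(Γ₀(N))`** for every `N ≥ 1`; with Manin's
  bound (`ModularCurveGenusBoundProofs`, `ModularCurveGenusIntegralityProofs`) this discharges the
  named facts `finrank_cuspForm_two_eq_genusX0 N` (`finrank_cuspForm_two_eq_genusX0_holds`,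
  Diamond–Shurman Thm. 3.5.1) and `twelve_mul_finrank_cuspForm_two (Γ₀(N))`
  (`twelve_mul_finrank_cuspForm_two_gamma0_holds`), and through the tree's Eichler–Shimura
  reduction `IsNewform0.plusPeriod_pos_and_minusPeriod_pos_of_genusX0_le` the named facts
  **`IsNewform0.minusPeriod_pos`** and **`IsNewform0.plusPeriod_pos`** of `ModularSymbols.lean`
  (`IsNewform0.minusPeriod_pos_holds`, `IsNewform0.plusPeriod_pos_holds`; Cremona 1997 §2.8, §2.10).

## The cusp count (proof of `totalWeight_eq`)

* `PeriodicGrowth`: a `1`-periodic holomorphic `K` with `‖K‖ ≤ Ce^{2πay}`, `a < 1`, has a limit at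
  `i∞` (removable singularity of the cusp function, Mathlib
  `tendsto_limUnder_of_differentiable_on_punctured_nhds_of_isLittleO`), and is `O(e^{-2πy})` if the
  limit is `0`.
* `Projection`: for a `w`-periodic `G` the twisted averages `K_s = w⁻¹∑_{i<w} (G·e^{-2πisτ/w})(τ - i)`
  are `1`-periodic with `q_w^s K_s = P_sG` (the part of the `q_w`-expansion in degrees `≡ s (w)`);
  `coeffAt s G = lim K_s` is the `s`-th coefficient, and `∑_{s<w} q_w^s K_s = G` (DFT inversion,
  `sum_qParam_pow_mul_twistAvg`).
* `Orbits`: `T`-orbits on `SL₂(ℤ)/Γ₀(N)` — `width x` (the period of `T`), `orbitFin`, a chosen `base`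
  point per orbit and the offset `off x` (`T^{off x} base x = x`); `#(base points) = ν_∞`
  (`card_basePoints`, tree `card_orbits_T_eq_nuInfty`).
* `CuspOrder`: the row change `L` (block DFT matrices, `det L ≠ 0` by Vandermonde in roots of unity)
  gives `L·Φ(τ) = diag(q_{w(a)}^{off a}) · H(τ)` with `H → M₀` at `i∞`
  (`projMat_eq_mul`, `det_projMat`, `tendsto_det_coefMat`), where `M₀` is the matrix of `q_w`-expansion
  coefficients `(a_{off a}(F_j ∣ base a))`.
* `LimMat`: **`M₀` is nonsingular** (`limMat_mulVec_eq_zero`): a kernel vector `c` yields, with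
  level-one multipliers `m_j → 1`, a form `G = ∑ c_jm_jF_j` all of whose conjugates are `O(e^{-2πy})`,
  so `G/Δ ∈ M(Γ₀(N))` and uniqueness of basis expansions forces `c_jm_j = Δp_j`, whence `c_j = 0` at
  `i∞`.
* `CuspWeight`: hence `‖𝒟‖e^{2πty} → ‖det M₀‖/‖det L‖ ≠ 0` with `t = ∑_a off(a)/w(a)`; against
  `‖𝒟‖¹²e^{2πKy} → ‖c‖ ≠ 0` this gives `K = 12t` (`totalWeight_eq_twelve_mul_cuspExp`), and
  `2t = ∑_orbits (w - 1) = μ - ν_∞` (`two_mul_cuspExp`).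

No named facts; auxiliary definitions only. Everything is in `namespace Literature.ModularForms` and proved.

## References

* T. Gannon, *The theory of vector-valued modular forms for the modular group*, Contrib. Math.
  Comput. Sci. 8, Springer (2014), 247–286 (arXiv:1310.4458), Thm. 3.4(b) and its proof, §3.5
  (dimensions of `M_k(Γ)` for finite-index `Γ` by induction of the trivial representation). [Gannon2014]
* C. Marks, G. Mason, *Structure of the module of vector-valued modular forms*, J. London Math.
  Soc. (2) 82 (2010), 32–48, §3. [MarksMason2010]
* F. Diamond, J. Shurman, *A first course in modular forms*, GTM 228, Springer (2005), Thm. 3.1.1,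
  Thm. 3.5.1, §3.8. [DiamondShurman2005]
* J. E. Cremona, *Algorithms for modular elliptic curves*, 2nd ed., Cambridge Univ. Press (1997),
  §2.8 (`Ω(f)`, `Ω_im(f)`), §2.10. [CremonaAlgorithms1997]
-/

noncomputable section

open UpperHalfPlane hiding I
open ModularForm Complex Matrix.SpecialLinearGroup Filter Asymptotics CongruenceSubgroup
open EisensteinSeries ModularGroup
open scoped MatrixGroups Real ModularForm Topology Manifold

namespace Literature.NumberTheory.EllipticCurves.ModularForms


/-! ### `1`-periodic holomorphic functions of growth `e^{2π a y}`, `a < 1`, at `i∞` -/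

section PeriodicGrowth

/-- **Removable singularity at the cusp**: a holomorphic `1`-periodic `K : ℍ → ℂ` with
`‖K(τ)‖ ≤ C e^{2π a Im τ}` for `Im τ ≥ A`, where `0 ≤ a < 1`, tends to a limit at `i∞` (its cusp
function `K̃(q)`, `q = e^{2πiτ}`, is `O(|q|^{-a}) = o(1/|q|)` near `0`, hence extends holomorphically
by Riemann's theorem, Mathlib `tendsto_limUnder_of_differentiable_on_punctured_nhds_of_isLittleO`).
[folklore] -/
theorem tendsto_atImInfty_of_norm_le_exp {K : ℍ → ℂ} (hhol : MDiff K)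
    (hper : Function.Periodic (K ∘ ofComplex) 1) {a C A : ℝ} (ha0 : 0 ≤ a) (ha : a < 1)
    (hbound : ∀ τ : ℍ, A ≤ τ.im → ‖K τ‖ ≤ C * Real.exp (2 * π * a * τ.im)) :
    Tendsto K atImInfty (𝓝 (cuspFunction 1 K 0)) := by
  set Kt : ℂ → ℂ := cuspFunction 1 K with hKt
  -- differentiability on a punctured neighbourhood of `0`
  have hdiff : ∀ᶠ q in 𝓝[≠] (0 : ℂ), DifferentiableAt ℂ Kt q := by
    refine Function.Periodic.eventually_differentiableAt_cuspFunction_nhds_ne_zero one_pos hper ?_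
    rw [Filter.eventually_iff_exists_mem]
    refine ⟨{z : ℂ | 0 < z.im}, ?_, fun z hz ↦ ?_⟩
    · rw [Filter.mem_comap]
      exact ⟨Set.Ioi 0, Filter.Ioi_mem_atTop 0, fun z hz ↦ hz⟩
    · exact UpperHalfPlane.mdifferentiableAt_iff.mp (hhol ⟨z, hz⟩)
  -- WLOG `C ≥ 0`, `A ≥ 1`
  set C₀ := max C 0 with hC₀
  set A₀ := max A 1 with hA₀
  have hbound' : ∀ τ : ℍ, A₀ ≤ τ.im → ‖K τ‖ ≤ C₀ * Real.exp (2 * π * a * τ.im) := fun τ hτ ↦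
    (hbound τ ((le_max_left _ _).trans hτ)).trans
      (mul_le_mul_of_nonneg_right (le_max_left _ _) (Real.exp_pos _).le)
  -- the bound on the cusp function near `0`: `‖Kt q - Kt 0‖ ≤ C' ‖q‖^{-a}`
  set C' := C₀ + ‖Kt 0‖ with hC'
  set δ : ℝ := min (1 / 2) (Real.exp (-(2 * π * A₀))) with hδ
  have hδpos : 0 < δ := lt_min (by norm_num) (Real.exp_pos _)
  have hnear : ∀ q : ℂ, q ≠ 0 → ‖q‖ < δ → ‖Kt q - Kt 0‖ ≤ C' * ‖q‖ ^ (-a) := by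
    intro q hq hqδ
    have hq0 : 0 < ‖q‖ := norm_pos_iff.mpr hq
    have hq1 : ‖q‖ < 1 := hqδ.trans_le ((min_le_left _ _).trans (by norm_num))
    have hlog : Real.log ‖q‖ ≤ -(2 * π * A₀) := by
      rw [← Real.log_exp (-(2 * π * A₀))]
      exact Real.log_le_log hq0 (hqδ.le.trans (min_le_right _ _))
    -- the preimage point
    set τq : ℂ := Function.Periodic.invQParam 1 q with hτq
    have him : τq.im = -1 / (2 * π) * Real.log ‖q‖ := Function.Periodic.im_invQParam 1 q
    have himA : A₀ ≤ τq.im := by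
      rw [him]
      have hπ : 0 < 2 * π := by positivity
      have : -1 / (2 * π) * Real.log ‖q‖ = (-Real.log ‖q‖) / (2 * π) := by ring
      rw [this, le_div_iff₀ hπ]
      linarith
    have hpos : 0 < τq.im := lt_of_lt_of_le (lt_of_lt_of_le one_pos (le_max_right A 1)) himA
    have hKq : Kt q = K ⟨τq, hpos⟩ := by
      rw [hKt, cuspFunction, Function.Periodic.cuspFunction_eq_of_nonzero 1 (K ∘ ofComplex) hq,
        Function.comp_apply, ofComplex_apply_of_im_pos hpos]
    have hrpow : Real.exp (2 * π * a * τq.im) = ‖q‖ ^ (-a) := by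
      rw [Real.rpow_def_of_pos hq0, him]
      congr 1
      field_simp
    have h1 : ‖Kt q‖ ≤ C₀ * ‖q‖ ^ (-a) := by
      rw [hKq, ← hrpow]
      exact hbound' ⟨τq, hpos⟩ himA
    have hone : 1 ≤ ‖q‖ ^ (-a) := Real.one_le_rpow_of_pos_of_le_one_of_nonpos hq0 hq1.le (by linarith)
    calc ‖Kt q - Kt 0‖ ≤ ‖Kt q‖ + ‖Kt 0‖ := norm_sub_le _ _
      _ ≤ C₀ * ‖q‖ ^ (-a) + ‖Kt 0‖ * ‖q‖ ^ (-a) := by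
          gcongr
          simpa using mul_le_mul_of_nonneg_left hone (norm_nonneg (Kt 0))
      _ = C' * ‖q‖ ^ (-a) := by rw [hC']; ring
  have hev : ∀ᶠ q in 𝓝[≠] (0 : ℂ), ‖Kt q - Kt 0‖ ≤ C' * ‖q‖ ^ (-a) := by
    rw [eventually_nhdsWithin_iff, Metric.eventually_nhds_iff]
    exact ⟨δ, hδpos, fun q hq hq0 ↦ hnear q hq0 (by simpa using hq)⟩
  -- `‖q‖^{-a} = o(1/‖q‖)`
  have hsmall : Tendsto (fun q : ℂ ↦ ‖q‖ ^ (1 - a)) (𝓝[≠] 0) (𝓝 0) := by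
    have h1 : Tendsto (fun q : ℂ ↦ ‖q‖) (𝓝[≠] (0 : ℂ)) (𝓝 0) := by
      have := (continuous_norm.tendsto (0 : ℂ))
      rw [norm_zero] at this
      exact this.mono_left nhdsWithin_le_nhds
    have h2 : ContinuousAt (fun x : ℝ ↦ x ^ (1 - a)) 0 :=
      Real.continuousAt_rpow_const 0 (1 - a) (Or.inr (by linarith))
    have := h2.tendsto.comp h1
    rwa [Real.zero_rpow (by linarith)] at this
  have ho : (fun q ↦ Kt q - Kt 0) =o[𝓝[≠] (0 : ℂ)] fun q ↦ (q - 0)⁻¹ := by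
    refine Asymptotics.isLittleO_iff.mpr fun ε hε ↦ ?_
    have hC'0 : 0 ≤ C' := add_nonneg (le_max_right _ _) (norm_nonneg _)
    have hev2 : ∀ᶠ q : ℂ in 𝓝[≠] 0, (C' + 1) * ‖q‖ ^ (1 - a) ≤ ε := by
      have := hsmall.const_mul (C' + 1)
      rw [mul_zero] at this
      exact (this.eventually (ge_mem_nhds hε)).mono fun q hq ↦ hq
    have hev3 : ∀ᶠ q : ℂ in 𝓝[≠] 0, q ≠ 0 := eventually_mem_nhdsWithin
    filter_upwards [hev, hev2, hev3] with q hq hq2 hq3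
    have hq0 : 0 < ‖q‖ := norm_pos_iff.mpr hq3
    rw [sub_zero, norm_inv]
    calc ‖Kt q - Kt 0‖ ≤ C' * ‖q‖ ^ (-a) := hq
      _ ≤ (C' + 1) * ‖q‖ ^ (-a) :=
          mul_le_mul_of_nonneg_right (by linarith) (Real.rpow_nonneg hq0.le _)
      _ = (C' + 1) * (‖q‖ ^ (1 - a) * ‖q‖⁻¹) := by
          rw [← Real.rpow_neg_one, ← Real.rpow_add hq0, show (1 - a + -1 : ℝ) = -a by ring]
      _ ≤ ε * ‖q‖⁻¹ := by
          rw [← mul_assoc]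
          gcongr
  -- the limit of the cusp function
  have hlim := Complex.tendsto_limUnder_of_differentiable_on_punctured_nhds_of_isLittleO hdiff ho
  have hKt0 : Kt 0 = limUnder (𝓝[≠] 0) Kt :=
    Function.Periodic.cuspFunction_zero_eq_limUnder_nhds_ne 1 (K ∘ ofComplex)
  rw [← hKt0] at hlim
  have hq : Tendsto (fun τ : ℍ ↦ Function.Periodic.qParam 1 τ) atImInfty (𝓝[≠] 0) :=
    tendsto_nhdsWithin_iff.mpr ⟨qParam_tendsto_atImInfty one_pos,
      Filter.Eventually.of_forall fun τ ↦ Function.Periodic.qParam_ne_zero _⟩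
  exact (hlim.comp hq).congr fun τ ↦ eq_cuspFunction τ one_ne_zero hper

/-- Under the same hypotheses `K` is bounded at `i∞`. [folklore] -/
theorem isBoundedAtImInfty_of_norm_le_exp {K : ℍ → ℂ} (hhol : MDiff K)
    (hper : Function.Periodic (K ∘ ofComplex) 1) {a C A : ℝ} (ha0 : 0 ≤ a) (ha : a < 1)
    (hbound : ∀ τ : ℍ, A ≤ τ.im → ‖K τ‖ ≤ C * Real.exp (2 * π * a * τ.im)) :
    IsBoundedAtImInfty K :=
  (tendsto_atImInfty_of_norm_le_exp hhol hper ha0 ha hbound).isBigO_one ℝ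

/-- If moreover the limit is `0`, then `K = O(e^{-2π Im τ})` at `i∞` (a holomorphic `1`-periodic
function vanishing at the cusp decays like `q`). [folklore] -/
theorem isBigO_exp_of_norm_le_exp {K : ℍ → ℂ} (hhol : MDiff K)
    (hper : Function.Periodic (K ∘ ofComplex) 1) {a C A : ℝ} (ha0 : 0 ≤ a) (ha : a < 1)
    (hbound : ∀ τ : ℍ, A ≤ τ.im → ‖K τ‖ ≤ C * Real.exp (2 * π * a * τ.im))
    (h0 : cuspFunction 1 K 0 = 0) :
    K =O[atImInfty] fun τ : ℍ ↦ Real.exp (-2 * π * τ.im) := by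
  have hlim := tendsto_atImInfty_of_norm_le_exp hhol hper ha0 ha hbound
  rw [h0] at hlim
  have := UpperHalfPlane.IsZeroAtImInfty.exp_decay_atImInfty (h := 1) hlim one_pos hper hhol
    (isBoundedAtImInfty_of_norm_le_exp hhol hper ha0 ha hbound)
  simpa using this

end PeriodicGrowth

/-! ### Translates, the twisted average `K_s`, and the projections `P_s` of a `w`-periodic function -/

section Projection

/-- Integer translate `G(τ + n)`, realised through `Tⁿ`. [folklore] -/
def transl (n : ℤ) (G : ℍ → ℂ) : ℍ → ℂ := fun τ ↦ G ((ModularGroup.T ^ n) • τ)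

/-- `transl n G = G ∣₀ Tⁿ`. [folklore] -/
theorem transl_eq_slash (n : ℤ) (G : ℍ → ℂ) :
    transl n G = G ∣[(0 : ℤ)] ((ModularGroup.T ^ n : SL(2, ℤ)) : GL (Fin 2) ℝ) := by
  funext τ
  rw [← ModularForm.SL_slash, ModularForm.SL_slash_apply]
  simp [transl]

/-- Translates of holomorphic functions are holomorphic. [folklore] -/
theorem mdifferentiable_transl (n : ℤ) {G : ℍ → ℂ} (hG : MDiff G) : MDiff (transl n G) := by
  rw [transl_eq_slash]
  exact hG.slash _ _

/-- `Tⁿ · τ = τ + n` as complex numbers, and the imaginary part is unchanged. [folklore] -/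
theorem coe_T_zpow_smul (n : ℤ) (τ : ℍ) :
    (((ModularGroup.T ^ n) • τ : ℍ) : ℂ) = (τ : ℂ) + n ∧ ((ModularGroup.T ^ n) • τ).im = τ.im := by
  rw [UpperHalfPlane.modular_T_zpow_smul]
  exact ⟨by simp [UpperHalfPlane.coe_vadd, add_comm], by simp⟩

/-- Composition of translates. [folklore] -/
theorem transl_transl (m n : ℤ) (G : ℍ → ℂ) : transl m (transl n G) = transl (m + n) G := by
  funext τ
  simp only [transl, smul_smul, ← zpow_add, add_comm]

variable (w : ℕ) [NeZero w]

/-- `e_w(s, τ) = e^{-2πi s τ / w}`, of absolute value `e^{2π s Im τ / w}`. [folklore] -/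
def twist (s : ℕ) (τ : ℍ) : ℂ := Complex.exp (-(2 * π * I * s * (τ : ℂ) / w))

omit [NeZero w] in
/-- `‖e_w(s, τ)‖ = e^{2π s Im τ/w}`. [folklore] -/
theorem norm_twist (s : ℕ) (τ : ℍ) : ‖twist w s τ‖ = Real.exp (2 * π * s * τ.im / w) := by
  rw [twist, Complex.norm_exp]
  congr 1
  simp only [neg_re, ← UpperHalfPlane.coe_im]
  have : (2 * π * I * s * (τ : ℂ) / w : ℂ) = ((2 * π * s / w : ℝ) : ℂ) * (I * (τ : ℂ)) := by
    push_cast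
    ring
  rw [this, Complex.re_ofReal_mul, Complex.mul_re, Complex.I_re, Complex.I_im]
  ring

omit [NeZero w] in
/-- `e_w(s, τ + n) = ζ^{-sn} e_w(s, τ)` — in particular `e_w(s, ·)` is `w`-periodic. [folklore] -/
theorem twist_T_zpow_smul (s : ℕ) (n : ℤ) (τ : ℍ) :
    twist w s ((ModularGroup.T ^ n) • τ) = Complex.exp (-(2 * π * I * s * n / w)) * twist w s τ := by
  rw [twist, twist, (coe_T_zpow_smul n τ).1, ← Complex.exp_add]
  congr 1
  ring

/-- `e_w(s, τ + w) = e_w(s, τ)`. [folklore] -/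
theorem twist_T_pow_w_smul (s : ℕ) (τ : ℍ) :
    twist w s ((ModularGroup.T ^ (w : ℤ)) • τ) = twist w s τ := by
  rw [twist_T_zpow_smul]
  have : Complex.exp (-(2 * π * I * s * (w : ℤ) / w)) = 1 := by
    have hw : (w : ℂ) ≠ 0 := by exact_mod_cast NeZero.ne w
    rw [show (-(2 * π * I * s * (w : ℤ) / w) : ℂ) = (-(s : ℤ) : ℤ) * (2 * π * I) by
      push_cast; field_simp]
    exact Complex.exp_int_mul_two_pi_mul_I _
  rw [this, one_mul]

/-- The **twisted average** `K_s(τ) = w⁻¹ ∑_{i<w} (G · e_w(s,·))(τ - i)`: for `w`-periodic `G` it is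
`1`-periodic, and `K_s · q_w^s = P_s G`, the projection of `G` onto the `q_w`-frequencies
`≡ s (mod w)`. [folklore] -/
def twistAvg (s : ℕ) (G : ℍ → ℂ) : ℍ → ℂ :=
  fun τ ↦ (w : ℂ)⁻¹ * ∑ i ∈ Finset.range w, transl (-(i : ℤ)) (fun σ ↦ G σ * twist w s σ) τ

variable {w}

/-- A finite average of translates by one full period of a `w`-periodic function is `1`-periodic.
[folklore] -/
theorem sum_range_transl_T_smul {f : ℍ → ℂ} (hf : ∀ τ, f ((ModularGroup.T ^ (w : ℤ)) • τ) = f τ) (τ : ℍ) :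
    ∑ i ∈ Finset.range w, transl (-(i : ℤ)) f (ModularGroup.T • τ) =
      ∑ i ∈ Finset.range w, transl (-(i : ℤ)) f τ := by
  obtain ⟨w', hw'⟩ : ∃ w', w = w' + 1 := ⟨w - 1, (Nat.succ_pred_eq_of_pos (NeZero.pos w)).symm⟩
  simp only [transl, smul_smul, ← zpow_add_one]
  rw [hw', Finset.sum_range_succ', Finset.sum_range_succ]
  congr 1
  · refine Finset.sum_congr rfl fun i _ ↦ ?_
    congr 2
    push_cast
    ring
  · -- `f(T τ) = f(T^{-w'} τ)` by periodicity
    have := hf ((ModularGroup.T ^ (-(w' : ℤ))) • τ)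
    rw [smul_smul, ← zpow_add] at this
    rw [show (-((0 : ℕ) : ℤ) + 1 : ℤ) = 1 from by norm_num, zpow_one]
    rw [show ((w : ℤ) + -(w' : ℤ)) = 1 by rw [hw']; push_cast; ring, zpow_one] at this
    exact this

/-- `K_s` is `1`-periodic for `w`-periodic `G`. [folklore] -/
theorem twistAvg_T_smul {s : ℕ} {G : ℍ → ℂ} (hG : ∀ τ, G ((ModularGroup.T ^ (w : ℤ)) • τ) = G τ) (τ : ℍ) :
    twistAvg w s G (ModularGroup.T • τ) = twistAvg w s G τ := by
  unfold twistAvg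
  rw [sum_range_transl_T_smul]
  intro σ
  simp only [hG σ, twist_T_pow_w_smul]

/-- `K_s ∘ ofComplex` is `1`-periodic. [folklore] -/
theorem periodic_twistAvg {s : ℕ} {G : ℍ → ℂ} (hG : ∀ τ, G ((ModularGroup.T ^ (w : ℤ)) • τ) = G τ) :
    Function.Periodic (twistAvg w s G ∘ ofComplex) 1 := by
  have h : twistAvg w s G ∣[(0 : ℤ)] ((ModularGroup.T ^ (1 : ℤ) : SL(2, ℤ)) : GL (Fin 2) ℝ) = twistAvg w s G := by
    rw [← transl_eq_slash]
    funext τ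
    simp only [transl, zpow_one, twistAvg_T_smul hG]
  have := periodic_comp_ofComplex_of_slash_T_zpow h
  simpa using this

omit [NeZero w] in
/-- `K_s` is holomorphic. [folklore] -/
theorem mdifferentiable_twistAvg (s : ℕ) {G : ℍ → ℂ} (hG : MDiff G) : MDiff (twistAvg w s G) := by
  have htw : MDiff (fun σ ↦ G σ * twist w s σ) := by
    refine hG.mul ?_
    intro τ
    unfold twist
    rw [UpperHalfPlane.mdifferentiableAt_iff]
    have : (fun σ : ℍ ↦ Complex.exp (-(2 * π * I * s * (σ : ℂ) / w))) ∘ ofComplex =ᶠ[𝓝 (τ : ℂ)]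
        fun z ↦ Complex.exp (-(2 * π * I * s * z / w)) := by
      filter_upwards [isOpen_upperHalfPlaneSet.mem_nhds τ.im_pos] with z hz
      simp [ofComplex_apply_of_im_pos hz]
    refine DifferentiableAt.congr_of_eventuallyEq ?_ this
    fun_prop
  have hsum := mdifferentiable_finset_sum (Finset.range w) (f := fun i ↦ transl (-(i : ℤ)) fun σ ↦ G σ * twist w s σ)
    fun i _ ↦ mdifferentiable_transl _ htw
  have : twistAvg w s G = fun τ ↦ (w : ℂ)⁻¹ * (∑ i ∈ Finset.range w, transl (-(i : ℤ)) fun σ ↦ G σ * twist w s σ) τ := by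
    funext τ
    simp only [twistAvg, Finset.sum_apply]
  rw [this]
  exact mdifferentiable_const.mul hsum

/-- **Growth of `K_s`**: if `‖G‖ ≤ B` on `Im ≥ A` then `‖K_s(τ)‖ ≤ B e^{2π s Im τ / w}` there. [folklore] -/
theorem norm_twistAvg_le {s : ℕ} {G : ℍ → ℂ} {B A : ℝ} (hB : ∀ τ : ℍ, A ≤ τ.im → ‖G τ‖ ≤ B) (τ : ℍ)
    (hτ : A ≤ τ.im) : ‖twistAvg w s G τ‖ ≤ B * Real.exp (2 * π * (s / w) * τ.im) := by
  unfold twistAvg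
  have hw : (0 : ℝ) < w := by exact_mod_cast NeZero.pos w
  rw [norm_mul, norm_inv, Complex.norm_natCast]
  have hterm : ∀ i ∈ Finset.range w, ‖transl (-(i : ℤ)) (fun σ ↦ G σ * twist w s σ) τ‖ ≤
      B * Real.exp (2 * π * (s / w) * τ.im) := by
    intro i _
    simp only [transl, norm_mul, norm_twist, (coe_T_zpow_smul (-(i : ℤ)) τ).2]
    rw [show 2 * π * s * τ.im / w = 2 * π * (s / w) * τ.im by ring]
    exact mul_le_mul_of_nonneg_right (hB _ (by rw [(coe_T_zpow_smul (-(i : ℤ)) τ).2]; exact hτ))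
      (Real.exp_pos _).le
  calc (w : ℝ)⁻¹ * ‖∑ i ∈ Finset.range w, transl (-(i : ℤ)) (fun σ ↦ G σ * twist w s σ) τ‖
      ≤ (w : ℝ)⁻¹ * ∑ i ∈ Finset.range w, ‖transl (-(i : ℤ)) (fun σ ↦ G σ * twist w s σ) τ‖ := by
        gcongr
        exact norm_sum_le _ _
    _ ≤ (w : ℝ)⁻¹ * ∑ i ∈ Finset.range w, B * Real.exp (2 * π * (s / w) * τ.im) := by
        gcongr with i hi
        exact hterm i hi
    _ = B * Real.exp (2 * π * (s / w) * τ.im) := by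
        rw [Finset.sum_const, Finset.card_range, nsmul_eq_mul]
        field_simp

/-- **The `s`-th coefficient** of a `w`-periodic bounded holomorphic `G`: the limit of `K_s` at
`i∞` (the value at `0` of its cusp function). [folklore] -/
def coeffAt (s : ℕ) (G : ℍ → ℂ) : ℂ := cuspFunction 1 (twistAvg w s G) 0

/-- `K_s → coeffAt s G` at `i∞`, for `s < w`. [folklore] -/
theorem tendsto_twistAvg {s : ℕ} (hs : s < w) {G : ℍ → ℂ} (hG : ∀ τ, G ((ModularGroup.T ^ (w : ℤ)) • τ) = G τ)
    (hhol : MDiff G) (hbdd : IsBoundedAtImInfty G) :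
    Tendsto (twistAvg w s G) atImInfty (𝓝 (coeffAt (w := w) s G)) := by
  obtain ⟨B, A, hBA⟩ : ∃ B A : ℝ, ∀ τ : ℍ, A ≤ τ.im → ‖G τ‖ ≤ B := by
    rw [UpperHalfPlane.isBoundedAtImInfty_iff] at hbdd
    exact hbdd
  have hw : (0 : ℝ) < w := by exact_mod_cast NeZero.pos w
  exact tendsto_atImInfty_of_norm_le_exp (mdifferentiable_twistAvg s hhol) (periodic_twistAvg hG)
    (a := s / w) (div_nonneg (Nat.cast_nonneg s) hw.le) ((div_lt_one hw).mpr (by exact_mod_cast hs))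
    (fun τ hτ ↦ norm_twistAvg_le hBA τ hτ)

/-- If the `s`-th coefficient vanishes then `K_s = O(e^{-2π y})`. [folklore] -/
theorem isBigO_twistAvg_of_coeffAt_eq_zero {s : ℕ} (hs : s < w) {G : ℍ → ℂ}
    (hG : ∀ τ, G ((ModularGroup.T ^ (w : ℤ)) • τ) = G τ) (hhol : MDiff G) (hbdd : IsBoundedAtImInfty G)
    (h0 : coeffAt (w := w) s G = 0) :
    twistAvg w s G =O[atImInfty] fun τ : ℍ ↦ Real.exp (-2 * π * τ.im) := by
  obtain ⟨B, A, hBA⟩ : ∃ B A : ℝ, ∀ τ : ℍ, A ≤ τ.im → ‖G τ‖ ≤ B := by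
    rw [UpperHalfPlane.isBoundedAtImInfty_iff] at hbdd
    exact hbdd
  have hw : (0 : ℝ) < w := by exact_mod_cast NeZero.pos w
  exact isBigO_exp_of_norm_le_exp (mdifferentiable_twistAvg s hhol) (periodic_twistAvg hG)
    (a := s / w) (div_nonneg (Nat.cast_nonneg s) hw.le) ((div_lt_one hw).mpr (by exact_mod_cast hs))
    (fun τ hτ ↦ norm_twistAvg_le hBA τ hτ) h0

end Projection

/-! ### `T`-orbits on `SL₂(ℤ)/Γ₀(N)`: widths, base points, offsets -/

section Orbits

variable (N : ℕ) [NeZero N]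

local notation "𝕏" => SL(2, ℤ) ⧸ Gamma0 N

open scoped Classical

omit [NeZero N] in
/-- `Tᴺ` fixes every coset (`g⁻¹ T⁻ᴺ g ∈ Γ(N) ≤ Γ₀(N)`). [folklore] -/
theorem T_pow_N_smul (x : 𝕏) : (ModularGroup.T ^ N) • x = x := by
  induction x using QuotientGroup.induction_on with
  | H g =>
    rw [MulAction.Quotient.smul_mk, QuotientGroup.eq]
    have hT : (ModularGroup.T ^ (N : ℤ) : SL(2, ℤ)) ∈ CongruenceSubgroup.Gamma N := by
      have := ModularGroup_T_pow_mem_Gamma (N : ℤ) (N : ℤ) dvd_rfl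
      rwa [Int.natAbs_natCast] at this
    rw [zpow_natCast] at hT
    have hmem := Gamma_le_Gamma0 N ((CongruenceSubgroup.Gamma_normal N).conj_mem _ (inv_mem hT) g⁻¹)
    convert hmem using 1
    rw [smul_eq_mul, mul_inv_rev, inv_inv, mul_assoc]

/-- The **width** `w(x)` of the cusp through `x`: the period of `T` on the coset `x`. [folklore] -/
def width (x : 𝕏) : ℕ := MulAction.period ModularGroup.T x

/-- `0 < w(x)`. [folklore] -/
theorem width_pos (x : 𝕏) : 0 < width N x :=
  MulAction.period_pos_of_fixed (NeZero.pos N) (T_pow_N_smul N x)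

omit [NeZero N] in
/-- `T^{w(x)} x = x`. [folklore] -/
theorem T_pow_width_smul (x : 𝕏) : ModularGroup.T ^ width N x • x = x := MulAction.pow_period_smul _ _

omit [NeZero N] in
/-- Periodicity modulo the width: `T^i x = T^{i % w} x`. [folklore] -/
theorem T_pow_mod_width_smul (x : 𝕏) (i : ℕ) : ModularGroup.T ^ (i % width N x) • x = ModularGroup.T ^ i • x :=
  MulAction.pow_mod_period_smul i

omit [NeZero N] in
/-- `T^i x = x ↔ w(x) ∣ i`. [folklore] -/
theorem T_pow_smul_eq_iff (x : 𝕏) (i : ℕ) : ModularGroup.T ^ i • x = x ↔ width N x ∣ i :=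
  MulAction.pow_smul_eq_iff_period_dvd

omit [NeZero N] in
/-- Injectivity of `i ↦ T^i x` below the width. [folklore] -/
theorem T_pow_smul_injOn (x : 𝕏) {i i' : ℕ} (hi : i < width N x) (hi' : i' < width N x)
    (h : ModularGroup.T ^ i • x = ModularGroup.T ^ i' • x) : i = i' := by
  have key : ∀ i i' : ℕ, i' < width N x → i < i' →
      ModularGroup.T ^ i • x = ModularGroup.T ^ i' • x → False := by
    intro i i' hi' hlt h
    have hfix : ModularGroup.T ^ (i' - i) • x = x := by
      have e : ModularGroup.T ^ i • (ModularGroup.T ^ (i' - i) • x) = ModularGroup.T ^ i • x := by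
        rw [smul_smul, ← pow_add, Nat.add_sub_cancel' hlt.le, ← h]
      exact smul_left_cancel _ e
    exact MulAction.pow_smul_ne_of_lt_period (by omega) (by unfold width at hi'; omega) hfix
  by_contra hne
  rcases Nat.lt_or_gt_of_ne hne with hlt | hlt
  · exact key i i' hi' hlt h
  · exact key i' i hi hlt h.symm

/-- The width is constant along `T`-orbits. [folklore] -/
theorem width_T_pow_smul (x : 𝕏) (i : ℕ) : width N (ModularGroup.T ^ i • x) = width N x := by
  have hx : x ∈ Function.periodicPts (fun y : 𝕏 ↦ ModularGroup.T • y) :=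
    Function.mem_periodicPts.mpr ⟨N, NeZero.pos N, by
      rw [Function.IsPeriodicPt, Function.IsFixedPt, smul_iterate_apply]
      exact T_pow_N_smul N x⟩
  have := Function.minimalPeriod_apply_iterate hx i
  rw [smul_iterate_apply] at this
  exact this

/-- The `T`-orbit of `x` as a finset: `{T^i x : i < w(x)}`. [folklore] -/
def orbitFin (x : 𝕏) : Finset 𝕏 := (Finset.range (width N x)).image fun i ↦ ModularGroup.T ^ i • x

omit [NeZero N] in
/-- Membership in `orbitFin`. [folklore] -/
theorem mem_orbitFin {x y : 𝕏} : y ∈ orbitFin N x ↔ ∃ i < width N x, ModularGroup.T ^ i • x = y := by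
  simp [orbitFin]

/-- `x ∈ orbitFin x`. [folklore] -/
theorem self_mem_orbitFin (x : 𝕏) : x ∈ orbitFin N x :=
  (mem_orbitFin N).mpr ⟨0, width_pos N x, by simp⟩

/-- Every `T^i x` lies in `orbitFin x`. [folklore] -/
theorem T_pow_smul_mem_orbitFin (x : 𝕏) (i : ℕ) : ModularGroup.T ^ i • x ∈ orbitFin N x :=
  (mem_orbitFin N).mpr ⟨i % width N x, Nat.mod_lt _ (width_pos N x), T_pow_mod_width_smul N x i⟩

omit [NeZero N] in
/-- `#orbitFin x = w(x)`. [folklore] -/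
theorem card_orbitFin (x : 𝕏) : (orbitFin N x).card = width N x := by
  rw [orbitFin, Finset.card_image_of_injOn, Finset.card_range]
  intro i hi i' hi' h
  exact T_pow_smul_injOn N x (Finset.mem_range.mp hi) (Finset.mem_range.mp hi') h

/-- Membership in `orbitFin` with an unbounded exponent. [folklore] -/
theorem mem_orbitFin' {x y : 𝕏} : y ∈ orbitFin N x ↔ ∃ i : ℕ, ModularGroup.T ^ i • x = y := by
  rw [mem_orbitFin]
  constructor
  · rintro ⟨i, -, h⟩
    exact ⟨i, h⟩
  · rintro ⟨i, rfl⟩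
    exact ⟨i % width N x, Nat.mod_lt _ (width_pos N x), T_pow_mod_width_smul N x i⟩

/-- Symmetry of the orbit relation: if `T^i x = y` then `T^{i'} y = x` for some `i'`. [folklore] -/
theorem exists_T_pow_smul_eq_of_T_pow_smul_eq {x y : 𝕏} {i : ℕ} (h : ModularGroup.T ^ i • x = y) :
    ∃ i' : ℕ, ModularGroup.T ^ i' • y = x := by
  refine ⟨width N x - i % width N x, ?_⟩
  rw [← h, smul_smul, ← pow_add, T_pow_smul_eq_iff]
  have hr : i % width N x ≤ i := Nat.mod_le _ _
  have hr' : i % width N x < width N x := Nat.mod_lt _ (width_pos N x)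
  have : width N x - i % width N x + i = width N x + (i - i % width N x) := by omega
  rw [this]
  exact dvd_add dvd_rfl (Nat.dvd_sub_mod i)

/-- If `y ∈ orbitFin x` then the orbit finsets agree. [folklore] -/
theorem orbitFin_eq_of_mem {x y : 𝕏} (h : y ∈ orbitFin N x) : orbitFin N y = orbitFin N x := by
  obtain ⟨i₀, hi₀⟩ := (mem_orbitFin' N).mp h
  obtain ⟨i₁, hi₁⟩ := exists_T_pow_smul_eq_of_T_pow_smul_eq N hi₀
  ext z
  rw [mem_orbitFin', mem_orbitFin']
  constructor
  · rintro ⟨i, rfl⟩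
    exact ⟨i + i₀, by rw [pow_add, mul_smul, hi₀]⟩
  · rintro ⟨i, rfl⟩
    exact ⟨i + i₁, by rw [pow_add, mul_smul, hi₁]⟩

/-- The orbit finset is constant along the orbit. [folklore] -/
theorem orbitFin_T_pow_smul (x : 𝕏) (i : ℕ) : orbitFin N (ModularGroup.T ^ i • x) = orbitFin N x :=
  orbitFin_eq_of_mem N (T_pow_smul_mem_orbitFin N x i)

/-- The **base point** of the orbit of `x`: its element with the least index under the fixed
enumeration `SL₂(ℤ)/Γ₀(N) ≃ Fin μ`. [folklore] -/
def base (x : 𝕏) : 𝕏 :=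
  (cosetEquiv N).symm (((orbitFin N x).image (cosetEquiv N)).min'
    ⟨cosetEquiv N x, Finset.mem_image_of_mem _ (self_mem_orbitFin N x)⟩)

/-- The base point lies in the orbit. [folklore] -/
theorem base_mem_orbitFin (x : 𝕏) : base N x ∈ orbitFin N x := by
  unfold base
  have := Finset.min'_mem ((orbitFin N x).image (cosetEquiv N))
    ⟨cosetEquiv N x, Finset.mem_image_of_mem _ (self_mem_orbitFin N x)⟩
  obtain ⟨y, hy, hy'⟩ := Finset.mem_image.mp this
  rw [← hy', Equiv.symm_apply_apply]
  exact hy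

/-- The base point only depends on the orbit. [folklore] -/
theorem base_eq_of_mem {x y : 𝕏} (h : y ∈ orbitFin N x) : base N y = base N x := by
  unfold base
  have e := orbitFin_eq_of_mem N h
  congr 2
  rw [e]

/-- `base (T^i x) = base x`. [folklore] -/
theorem base_T_pow_smul (x : 𝕏) (i : ℕ) : base N (ModularGroup.T ^ i • x) = base N x :=
  base_eq_of_mem N (T_pow_smul_mem_orbitFin N x i)

/-- `x` is in the orbit of its base point: `∃ i, T^i (base x) = x`. [folklore] -/
theorem exists_T_pow_base_smul (x : 𝕏) : ∃ i : ℕ, ModularGroup.T ^ i • base N x = x := by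
  obtain ⟨i, -, hi⟩ := (mem_orbitFin N).mp (base_mem_orbitFin N x)
  exact exists_T_pow_smul_eq_of_T_pow_smul_eq N hi

/-- The **offset** of `x` in its orbit: the least `i` with `T^i (base x) = x`. [folklore] -/
def off (x : 𝕏) : ℕ := Nat.find (exists_T_pow_base_smul N x)

/-- `T^{off x} (base x) = x`. [folklore] -/
theorem T_pow_off_smul_base (x : 𝕏) : ModularGroup.T ^ off N x • base N x = x := Nat.find_spec (exists_T_pow_base_smul N x)

/-- `w(base x) = w(x)`. [folklore] -/
theorem width_base (x : 𝕏) : width N (base N x) = width N x := by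
  conv_rhs => rw [← T_pow_off_smul_base N x]
  rw [width_T_pow_smul]

/-- `off x < w(x)`. [folklore] -/
theorem off_lt_width (x : 𝕏) : off N x < width N x := by
  obtain ⟨i', hi'⟩ := exists_T_pow_base_smul N x
  have h : ModularGroup.T ^ (i' % width N (base N x)) • base N x = x := by
    rw [T_pow_mod_width_smul, hi']
  rw [width_base] at h
  exact (Nat.find_min' _ h).trans_lt (Nat.mod_lt _ (width_pos N x))

/-- **The offsets enumerate the orbit**: `off (T^i (base x)) = i` for `i < w(x)`. [folklore] -/
theorem off_T_pow_smul_base (x : 𝕏) {i : ℕ} (hi : i < width N x) : off N (ModularGroup.T ^ i • base N x) = i := by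
  have hb : base N (ModularGroup.T ^ i • base N x) = base N x := by
    rw [base_T_pow_smul, base_eq_of_mem N (base_mem_orbitFin N x)]
  have h1 : ModularGroup.T ^ off N (ModularGroup.T ^ i • base N x) • base N x = ModularGroup.T ^ i • base N x := by
    have := T_pow_off_smul_base N (ModularGroup.T ^ i • base N x)
    rwa [hb] at this
  have h2 : off N (ModularGroup.T ^ i • base N x) < width N x := by
    have := off_lt_width N (ModularGroup.T ^ i • base N x)
    rwa [width_T_pow_smul, width_base] at this
  exact T_pow_smul_injOn N (base N x) (by rw [width_base]; exact h2) (by rw [width_base]; exact hi) h1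

end Orbits

/-! ### The DFT change of rows and the factorisation `Φ̃ = L · Φ`, `Φ̃_{a,j} = q_w^{s} · H_{a,j}` -/

section CuspOrder

variable (N : ℕ) [NeZero N]

local notation "𝕏" => SL(2, ℤ) ⧸ Gamma0 N

open scoped Classical

/-- `base (base x) = base x`. [folklore] -/
theorem base_base (x : 𝕏) : base N (base N x) = base N x := base_eq_of_mem N (base_mem_orbitFin N x)

/-- `NeZero (w x)`. [folklore] -/
instance neZero_width (x : 𝕏) : NeZero (width N x) := ⟨(width_pos N x).ne'⟩

omit [NeZero N] in
/-- Slashing by `Tⁿ` is translation, in every weight. [folklore] -/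
theorem slash_T_zpow_eq_transl (k n : ℤ) (G : ℍ → ℂ) :
    G ∣[k] ((ModularGroup.T ^ n : SL(2, ℤ)) : GL (Fin 2) ℝ) = transl n G := by
  funext τ
  rw [← ModularForm.SL_slash, ModularForm.SL_slash_apply, transl]
  have hd : denom ((ModularGroup.T ^ n : SL(2, ℤ)) : GL (Fin 2) ℝ) τ = 1 := by
    rw [ModularGroup.denom_apply]
    simp [ModularGroup.coe_T_zpow]
  rw [hd]
  simp

variable (wt : Fin (gamma0Index N) → ℤ) (F : Fin (gamma0Index N) → ℍ → ℂ)

/-- The row function of the coset `x`: `j ↦ F_j ∣ g⁻¹` (`x = gΓ₀(N)`). [folklore] -/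
def rowFun (x : 𝕏) (j : Fin (gamma0Index N)) : ℍ → ℂ := cosetSlash N (wt j) (F j) x

/-- `Φ(τ)_{a,j} = rowFun (e⁻¹ a) j τ`. [folklore] -/
theorem basisMatrix_eq_rowFun (τ : ℍ) (a j : Fin (gamma0Index N)) :
    basisMatrix N wt F τ a j = rowFun N wt F ((cosetEquiv N).symm a) j τ := rfl

variable {N wt F}

omit [NeZero N] in
/-- Translates of rows are rows: `(rowFun x j)(τ - i) = rowFun (Tⁱ x) j τ`. [folklore] -/
theorem transl_rowFun (hb : IsLevelOneBasis N wt F) (x : 𝕏) (j : Fin (gamma0Index N)) (i : ℕ) :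
    transl (-(i : ℤ)) (rowFun N wt F x j) = rowFun N wt F (ModularGroup.T ^ i • x) j := by
  rw [← slash_T_zpow_eq_transl (wt j), rowFun, cosetSlash_slash (slash_eq_of_mem_gamma0Space (hb.mem j)),
    zpow_neg, inv_inv, zpow_natCast]
  rfl

omit [NeZero N] in
/-- Rows are `w(x)`-periodic. [folklore] -/
theorem rowFun_T_pow_width_smul (hb : IsLevelOneBasis N wt F) (x : 𝕏) (j : Fin (gamma0Index N)) (τ : ℍ) :
    rowFun N wt F x j ((ModularGroup.T ^ (width N x : ℤ)) • τ) = rowFun N wt F x j τ := by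
  have h := slash_T_zpow_eq_transl (wt j) (width N x : ℤ) (rowFun N wt F x j)
  rw [rowFun, cosetSlash_slash (slash_eq_of_mem_gamma0Space (hb.mem j)), zpow_natCast,
    inv_smul_eq_iff.mpr (T_pow_width_smul N x).symm] at h
  have := congr_fun h τ
  rw [transl] at this
  exact this.symm

variable (N wt F)

/-- `ζ_x = e^{2πi/w(x)}`. [folklore] -/
def zetaW (x : 𝕏) : ℂ := Complex.exp (2 * π * I / width N x)

/-- `ζ_x` is a primitive `w(x)`-th root of unity. [folklore] -/
theorem isPrimitiveRoot_zetaW (x : 𝕏) : IsPrimitiveRoot (zetaW N x) (width N x) :=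
  Complex.isPrimitiveRoot_exp _ (width_pos N x).ne'

/-- The **DFT row-change matrix** `L_{a,b} = w⁻¹ ∑_{i<w, Tⁱ·base = b} ζ^{off(a)·i}` (block
diagonal over the `T`-orbits, each block a DFT matrix). [folklore] -/
def dftMat : Matrix (Fin (gamma0Index N)) (Fin (gamma0Index N)) ℂ := fun a b ↦
  ((width N ((cosetEquiv N).symm a) : ℂ))⁻¹ *
    ∑ i ∈ (Finset.range (width N ((cosetEquiv N).symm a))).filter
        (fun i ↦ ModularGroup.T ^ i • base N ((cosetEquiv N).symm a) = (cosetEquiv N).symm b),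
      zetaW N ((cosetEquiv N).symm a) ^ (off N ((cosetEquiv N).symm a) * i)

/-- The **projected matrix** `Φ̃(τ)_{a,j} = w⁻¹ ∑_{i<w} ζ^{off(a) i} (F_j ∣ ·)(Tⁱ base(a))(τ)
= P_{off a}(row of base(a))`. [folklore] -/
def projMat (τ : ℍ) : Matrix (Fin (gamma0Index N)) (Fin (gamma0Index N)) ℂ := fun a j ↦
  ((width N ((cosetEquiv N).symm a) : ℂ))⁻¹ *
    ∑ i ∈ Finset.range (width N ((cosetEquiv N).symm a)),
      zetaW N ((cosetEquiv N).symm a) ^ (off N ((cosetEquiv N).symm a) * i) *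
        basisMatrix N wt F τ (cosetEquiv N (ModularGroup.T ^ i • base N ((cosetEquiv N).symm a))) j

/-- `L *ᵥ v` unfolded. [folklore] -/
theorem dftMat_mulVec (v : Fin (gamma0Index N) → ℂ) (a : Fin (gamma0Index N)) :
    Matrix.mulVec (dftMat N) v a = ((width N ((cosetEquiv N).symm a) : ℂ))⁻¹ *
      ∑ i ∈ Finset.range (width N ((cosetEquiv N).symm a)),
        zetaW N ((cosetEquiv N).symm a) ^ (off N ((cosetEquiv N).symm a) * i) *
          v (cosetEquiv N (ModularGroup.T ^ i • base N ((cosetEquiv N).symm a))) := by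
  simp only [Matrix.mulVec, dotProduct, dftMat, Finset.sum_filter, mul_assoc, ← Finset.mul_sum]
  congr 1
  simp only [Finset.sum_mul, ite_mul, zero_mul]
  rw [Finset.sum_comm]
  refine Finset.sum_congr rfl fun i _ ↦ ?_
  simp_rw [Equiv.eq_symm_apply]
  rw [Finset.sum_ite_eq]
  simp

/-- **`Φ̃ = L · Φ`**. [folklore] -/
theorem projMat_eq_mul (τ : ℍ) : projMat N wt F τ = dftMat N * basisMatrix N wt F τ := by
  ext a j
  rw [Matrix.mul_apply']
  change _ = Matrix.mulVec (dftMat N) (fun b ↦ basisMatrix N wt F τ b j) a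
  rw [dftMat_mulVec]
  rfl

omit [NeZero N] in
/-- `e_w(s, τ - i) = ζ^{s i} e_w(s, τ)`. [folklore] -/
theorem twist_T_neg_pow_smul (x : 𝕏) (s i : ℕ) (τ : ℍ) :
    twist (width N x) s ((ModularGroup.T ^ (-(i : ℤ))) • τ) = zetaW N x ^ (s * i) * twist (width N x) s τ := by
  rw [twist_T_zpow_smul, zetaW, ← Complex.exp_nat_mul]
  congr 2
  push_cast
  ring

/-- `e_w(s, τ) · q_w(τ)^s = 1`. [folklore] -/
theorem twist_mul_qParam_pow (w : ℕ) [NeZero w] (s : ℕ) (τ : ℍ) :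
    twist w s τ * Function.Periodic.qParam w τ ^ s = 1 := by
  rw [twist, Function.Periodic.qParam, ← Complex.exp_nat_mul, ← Complex.exp_add]
  convert Complex.exp_zero using 2
  push_cast
  ring

variable {N wt F}

/-- **`Φ̃_{a,j} = q_w^{off a} · K_{off a}(row of base a)_j`**. [folklore] -/
theorem projMat_apply (hb : IsLevelOneBasis N wt F) (τ : ℍ) (a j : Fin (gamma0Index N)) :
    projMat N wt F τ a j = Function.Periodic.qParam (width N ((cosetEquiv N).symm a)) τ ^ off N ((cosetEquiv N).symm a) *
      twistAvg (width N ((cosetEquiv N).symm a)) (off N ((cosetEquiv N).symm a))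
        (rowFun N wt F (base N ((cosetEquiv N).symm a)) j) τ := by
  set x := (cosetEquiv N).symm a with hx
  simp only [projMat, twistAvg]
  rw [Finset.mul_sum, Finset.mul_sum, Finset.mul_sum]
  refine Finset.sum_congr rfl fun i _ ↦ ?_
  have hz : zetaW N (base N x) = zetaW N x := by rw [zetaW, zetaW, width_base]
  have h1 : transl (-(i : ℤ)) (fun σ ↦ rowFun N wt F (base N x) j σ * twist (width N x) (off N x) σ) τ =
      rowFun N wt F (ModularGroup.T ^ i • base N x) j τ * (zetaW N x ^ (off N x * i) * twist (width N x) (off N x) τ) := by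
    have := congr_fun (transl_rowFun hb (base N x) j i) τ
    simp only [transl] at this ⊢
    have htw := twist_T_neg_pow_smul N (base N x) (off N x) i τ
    rw [width_base, hz] at htw
    rw [this, htw]
  rw [h1, basisMatrix_eq_rowFun, Equiv.symm_apply_apply]
  have h2 := twist_mul_qParam_pow (width N x) (off N x) τ
  linear_combination (-(((width N x : ℂ))⁻¹ * rowFun N wt F (ModularGroup.T ^ i • base N x) j τ *
    zetaW N x ^ (off N x * i))) * h2

/-- **`L` is invertible**: on each `T`-orbit `L` is `w⁻¹ (ζ^{r m})_{r,m<w}`, a Vandermonde matrix in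
the distinct roots of unity `ζ^r`. [folklore] -/
theorem det_dftMat_ne_zero : (dftMat N).det ≠ 0 := by
  intro hdet
  obtain ⟨v, hv, hLv⟩ := (Matrix.exists_mulVec_eq_zero_iff (M := dftMat N)).mpr hdet
  apply hv
  funext b
  -- the orbit through `y = e⁻¹ b`
  set y := (cosetEquiv N).symm b with hy
  set w := width N y with hw
  set u : Fin w → ℂ := fun i ↦ v (cosetEquiv N (ModularGroup.T ^ (i : ℕ) • base N y)) with hu
  have hprim := isPrimitiveRoot_zetaW N y
  have hu0 : u = 0 := by
    refine Matrix.eq_zero_of_forall_index_sum_mul_pow_eq_zero (f := fun r : Fin w ↦ zetaW N y ^ (r : ℕ))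
      (fun r r' h ↦ Fin.ext (hprim.pow_inj r.2 r'.2 h)) fun r ↦ ?_
    -- row `a_r = e (T^r base y)` of `L v = 0`
    have hrow := congr_fun hLv (cosetEquiv N (ModularGroup.T ^ (r : ℕ) • base N y))
    rw [dftMat_mulVec, Pi.zero_apply, Equiv.symm_apply_apply, width_T_pow_smul, width_base,
      base_T_pow_smul, base_base, off_T_pow_smul_base N y r.2, mul_eq_zero] at hrow
    have hw0 : ((width N y : ℂ))⁻¹ ≠ 0 := inv_ne_zero (by exact_mod_cast (width_pos N y).ne')
    replace hrow := hrow.resolve_left hw0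
    rw [← hrow, ← hw, Finset.sum_range]
    refine Finset.sum_congr rfl fun i _ ↦ ?_
    have hz : zetaW N (ModularGroup.T ^ (r : ℕ) • base N y) = zetaW N y := by
      rw [zetaW, zetaW, width_T_pow_smul, width_base]
    rw [hz, hu, ← pow_mul, mul_comm]
  have : v b = u ⟨off N y, off_lt_width N y⟩ := by
    simp only [hu, T_pow_off_smul_base, hy, Equiv.apply_symm_apply]
  rw [this, hu0, Pi.zero_apply, Pi.zero_apply]

variable (N wt F)

/-- The **coefficient matrix** `H(τ)_{a,j} = K_{off a}(row of base a)_j(τ)`. [folklore] -/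
def coefMat (τ : ℍ) : Matrix (Fin (gamma0Index N)) (Fin (gamma0Index N)) ℂ := fun a j ↦
  twistAvg (width N ((cosetEquiv N).symm a)) (off N ((cosetEquiv N).symm a))
    (rowFun N wt F (base N ((cosetEquiv N).symm a)) j) τ

/-- The **limit matrix** `M₀_{a,j}` = the `off a`-th `q_w`-coefficient of `F_j ∣ (base a)`. [folklore] -/
def limMat : Matrix (Fin (gamma0Index N)) (Fin (gamma0Index N)) ℂ := fun a j ↦
  coeffAt (w := width N ((cosetEquiv N).symm a)) (off N ((cosetEquiv N).symm a))
    (rowFun N wt F (base N ((cosetEquiv N).symm a)) j)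

/-- The row factor `q_{w(a)}(τ)^{off a}`. [folklore] -/
def qFactor (a : Fin (gamma0Index N)) (τ : ℍ) : ℂ :=
  Function.Periodic.qParam (width N ((cosetEquiv N).symm a)) τ ^ off N ((cosetEquiv N).symm a)

/-- The **cusp exponent** `t = ∑_a off(a)/w(a)` (shown below to be `(μ - ν_∞)/2`). [folklore] -/
def cuspExp : ℝ := ∑ a : Fin (gamma0Index N), (off N ((cosetEquiv N).symm a) : ℝ) / width N ((cosetEquiv N).symm a)

variable {N wt F}

/-- **`det Φ̃ = (∏_a q_{w_a}^{off a}) · det H`**. [folklore] -/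
theorem det_projMat (hb : IsLevelOneBasis N wt F) (τ : ℍ) :
    (projMat N wt F τ).det = (∏ a, qFactor N a τ) * (coefMat N wt F τ).det := by
  rw [← Matrix.det_mul_column]
  congr 1
  ext a j
  rw [projMat_apply hb]
  rfl

/-- `‖∏_a q_{w_a}(τ)^{off a}‖ = e^{-2π t Im τ}`. [folklore] -/
theorem norm_prod_qFactor (τ : ℍ) : ‖∏ a, qFactor N a τ‖ = Real.exp (-2 * π * cuspExp N * τ.im) := by
  rw [norm_prod, cuspExp, Finset.mul_sum, Finset.sum_mul, Real.exp_sum]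
  refine Finset.prod_congr rfl fun a _ ↦ ?_
  rw [qFactor, norm_pow, Function.Periodic.norm_qParam, ← Real.exp_nat_mul, UpperHalfPlane.coe_im]
  congr 1
  have hw : (width N ((cosetEquiv N).symm a) : ℝ) ≠ 0 := by exact_mod_cast (width_pos N _).ne'
  field_simp

/-- `H(τ) → M₀` entrywise at `i∞`. [folklore] -/
theorem tendsto_coefMat (hb : IsLevelOneBasis N wt F) (a j : Fin (gamma0Index N)) :
    Tendsto (fun τ ↦ coefMat N wt F τ a j) atImInfty (𝓝 (limMat N wt F a j)) := by
  set x := (cosetEquiv N).symm a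
  refine tendsto_twistAvg (off_lt_width N x) (fun τ ↦ ?_) (mdifferentiable_cosetSlash (hb.mem j) _)
    (isBoundedAtImInfty_cosetSlash (hb.mem j) _)
  have := rowFun_T_pow_width_smul hb (base N x) j τ
  rwa [width_base] at this

/-- `det H(τ) → det M₀` at `i∞`. [folklore] -/
theorem tendsto_det_coefMat (hb : IsLevelOneBasis N wt F) :
    Tendsto (fun τ ↦ (coefMat N wt F τ).det) atImInfty (𝓝 (limMat N wt F).det) := by
  have hH : Tendsto (coefMat N wt F) atImInfty (𝓝 (limMat N wt F)) :=
    tendsto_pi_nhds.mpr fun a ↦ tendsto_pi_nhds.mpr fun j ↦ tendsto_coefMat hb a j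
  exact ((continuous_id.matrix_det).tendsto _).comp hH

/-- **DFT inversion**: `∑_{r<w} q_w^r K_r(G) = G` for `w`-periodic `G`. [folklore] -/
theorem sum_qParam_pow_mul_twistAvg (x : 𝕏) {G : ℍ → ℂ} (τ : ℍ) :
    ∑ r ∈ Finset.range (width N x), Function.Periodic.qParam (width N x) τ ^ r * twistAvg (width N x) r G τ = G τ := by
  set w := width N x with hw
  have hprim := isPrimitiveRoot_zetaW N x
  -- each term: `q^r K_r = w⁻¹ ∑_i ζ^{ri} G(τ - i)`
  have hterm : ∀ r, Function.Periodic.qParam w τ ^ r * twistAvg w r G τ =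
      (w : ℂ)⁻¹ * ∑ i ∈ Finset.range w, zetaW N x ^ (r * i) * G ((ModularGroup.T ^ (-(i : ℤ))) • τ) := by
    intro r
    simp only [twistAvg]
    rw [Finset.mul_sum, Finset.mul_sum, Finset.mul_sum]
    refine Finset.sum_congr rfl fun i _ ↦ ?_
    simp only [transl]
    rw [twist_T_neg_pow_smul]
    have h2 := twist_mul_qParam_pow w r τ
    linear_combination ((w : ℂ)⁻¹ * zetaW N x ^ (r * i) * G ((ModularGroup.T ^ (-(i : ℤ))) • τ)) * h2
  simp_rw [hterm]
  rw [← Finset.mul_sum, Finset.sum_comm]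
  -- geometric sums
  have hgeom : ∀ i ∈ Finset.range w, ∑ r ∈ Finset.range w, zetaW N x ^ (r * i) * G ((ModularGroup.T ^ (-(i : ℤ))) • τ) =
      if i = 0 then (w : ℂ) * G τ else 0 := by
    intro i hi
    rw [← Finset.sum_mul]
    split_ifs with h0
    · subst h0
      simp
    · have hne : zetaW N x ^ i ≠ 1 := hprim.pow_ne_one_of_pos_of_lt h0 (Finset.mem_range.mp hi)
      have : ∑ r ∈ Finset.range w, zetaW N x ^ (r * i) = 0 := by
        simp_rw [mul_comm _ i, pow_mul]
        rw [geom_sum_eq hne, ← pow_mul, mul_comm, pow_mul, hprim.pow_eq_one, one_pow, sub_self, zero_div]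
      rw [this, zero_mul]
  rw [Finset.sum_congr rfl hgeom, Finset.sum_ite_eq']
  simp only [Finset.mem_range]
  rw [if_pos (width_pos N x)]
  have hw0 : (w : ℂ) ≠ 0 := by exact_mod_cast (width_pos N x).ne'
  field_simp

/-- **Slashing a quotient by `Δ`**: `(f/Δ) ∣_{k-12} g = (f ∣_k g)/Δ` for `g ∈ SL₂(ℤ)`. [folklore] -/
theorem div_discriminant_slash (k : ℤ) (f : ℍ → ℂ) (g : SL(2, ℤ)) :
    (fun τ ↦ f τ / ModularForm.discriminant τ) ∣[k - 12] (g : GL (Fin 2) ℝ) =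
      fun τ ↦ (f ∣[k] (g : GL (Fin 2) ℝ)) τ / ModularForm.discriminant τ := by
  funext τ
  rw [← ModularForm.SL_slash, ← ModularForm.SL_slash, ModularForm.SL_slash_apply, ModularForm.SL_slash_apply]
  have hΔ := congr_fun (discriminant_slash g) τ
  rw [← ModularForm.SL_slash, ModularForm.SL_slash_apply] at hΔ
  have hd : denom (g : GL (Fin 2) ℝ) τ ≠ 0 := UpperHalfPlane.denom_ne_zero _ _
  have hΔ0 : ModularForm.discriminant τ ≠ 0 := discriminant_ne_zero τ
  have hΔ1 : ModularForm.discriminant (g • τ) ≠ 0 := discriminant_ne_zero _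
  rw [← hΔ, show (-(k - 12) : ℤ) = -k - (-12 : ℤ) by ring, zpow_sub₀ hd]
  field_simp

/-- A function that is `O(e^{-2πy})` at `i∞` stays bounded after division by `Δ`. [folklore] -/
theorem isBoundedAtImInfty_div_discriminant {f : ℍ → ℂ}
    (hO : f =O[atImInfty] fun τ : ℍ ↦ Real.exp (-2 * π * τ.im)) :
    IsBoundedAtImInfty fun τ ↦ f τ / ModularForm.discriminant τ := by
  -- `e^{-2πy} / Δ` is bounded (tends to norm `1`)
  have h1 : (fun τ : ℍ ↦ Real.exp (-2 * π * τ.im)) =O[atImInfty] ModularForm.discriminant := by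
    have ht := tendsto_norm_discriminant_mul_exp
    have hev : ∀ᶠ τ : ℍ in atImInfty, 1 / 2 ≤ ‖ModularForm.discriminant τ‖ * Real.exp (2 * π * τ.im) :=
      (ht.eventually (lt_mem_nhds (by norm_num : (1 / 2 : ℝ) < 1))).mono fun τ hτ ↦ hτ.le
    refine Asymptotics.IsBigO.of_bound 2 ?_
    filter_upwards [hev] with τ hτ
    rw [Real.norm_eq_abs, abs_of_pos (Real.exp_pos _)]
    have hexp : Real.exp (-2 * π * τ.im) * Real.exp (2 * π * τ.im) = 1 := by
      rw [← Real.exp_add]; simp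
    nlinarith [Real.exp_pos (-2 * π * τ.im), Real.exp_pos (2 * π * τ.im), norm_nonneg (ModularForm.discriminant τ)]
  have h2 := hO.trans h1
  -- `f / Δ = O(1)`
  have h3 := h2.mul (Asymptotics.isBigO_refl (fun τ : ℍ ↦ (ModularForm.discriminant τ)⁻¹) atImInfty)
  have h4 : (fun τ ↦ f τ / ModularForm.discriminant τ) =O[atImInfty] (fun _ : ℍ ↦ (1 : ℂ)) :=
    h3.congr (fun τ ↦ (div_eq_mul_inv _ _).symm) fun τ ↦ mul_inv_cancel₀ (discriminant_ne_zero τ)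
  exact (Asymptotics.isBigO_one_iff ℝ).mpr ((Asymptotics.isBigO_one_iff ℂ).mp h4)

omit [NeZero N] in
/-- Translation preserves `O(e^{-2πy})` at `i∞`. [folklore] -/
theorem isBigO_transl {f : ℍ → ℂ} (n : ℤ) (hO : f =O[atImInfty] fun τ : ℍ ↦ Real.exp (-2 * π * τ.im)) :
    transl n f =O[atImInfty] fun τ : ℍ ↦ Real.exp (-2 * π * τ.im) := by
  have ht : Tendsto (fun τ : ℍ ↦ (ModularGroup.T ^ n) • τ) atImInfty atImInfty := by
    rw [atImInfty, Filter.tendsto_comap_iff]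
    have : UpperHalfPlane.im ∘ (fun τ : ℍ ↦ (ModularGroup.T ^ n) • τ) = UpperHalfPlane.im := by
      funext τ
      exact (coe_T_zpow_smul n τ).2
    rw [this]
    exact Filter.tendsto_comap
  have := hO.comp_tendsto ht
  refine this.congr_right fun τ ↦ ?_
  simp only [Function.comp_apply, (coe_T_zpow_smul n τ).2]

omit [NeZero N] in
/-- `cosetSlash (Tⁱ x) = transl (-i) (cosetSlash x)`. [folklore] -/
theorem transl_cosetSlash {k : ℤ} {G : ℍ → ℂ} (hG : G ∈ gamma0Space N k) (x : 𝕏) (i : ℕ) :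
    transl (-(i : ℤ)) (cosetSlash N k G x) = cosetSlash N k G (ModularGroup.T ^ i • x) := by
  rw [← slash_T_zpow_eq_transl k, cosetSlash_slash (slash_eq_of_mem_gamma0Space hG), zpow_neg, inv_inv,
    zpow_natCast]

omit [NeZero N] in
/-- `cosetSlash x` is `w(x)`-periodic. [folklore] -/
theorem cosetSlash_T_pow_width_smul {k : ℤ} {G : ℍ → ℂ} (hG : G ∈ gamma0Space N k) (x : 𝕏) (τ : ℍ) :
    cosetSlash N k G x ((ModularGroup.T ^ (width N x : ℤ)) • τ) = cosetSlash N k G x τ := by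
  have h := slash_T_zpow_eq_transl k (width N x : ℤ) (cosetSlash N k G x)
  rw [cosetSlash_slash (slash_eq_of_mem_gamma0Space hG), zpow_natCast,
    inv_smul_eq_iff.mpr (T_pow_width_smul N x).symm] at h
  have := congr_fun h τ
  rw [transl] at this
  exact this.symm

/-- **Linearity of `K_s` over `1`-periodic coefficients**: for level-one `p_j`,
`K_s(∑ p_j G_j) = ∑ p_j K_s(G_j)`. [folklore] -/
theorem twistAvg_sum_levelOne_mul (w : ℕ) [NeZero w] (s : ℕ) {ι : Type*} (S : Finset ι) {d : ι → ℤ}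
    {p G : ι → ℍ → ℂ} (hp : ∀ j ∈ S, p j ∈ levelOneSpace (d j)) (τ : ℍ) :
    twistAvg w s (∑ j ∈ S, p j * G j) τ = ∑ j ∈ S, p j τ * twistAvg w s (G j) τ := by
  simp only [twistAvg, transl, Finset.sum_apply, Pi.mul_apply, Finset.sum_mul, Finset.mul_sum]
  rw [Finset.sum_comm]
  refine Finset.sum_congr rfl fun j hj ↦ Finset.sum_congr rfl fun i _ ↦ ?_
  have hper : p j ((ModularGroup.T ^ (-(i : ℤ))) • τ) = p j τ := by
    have := congr_fun (slash_eq_of_mem_formSpace (hp j hj) (γ := ((ModularGroup.T ^ (-(i : ℤ)) : SL(2, ℤ)) : GL (Fin 2) ℝ))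
      ⟨_, rfl⟩) τ
    rwa [slash_T_zpow_eq_transl, transl] at this
  rw [hper]
  ring

end CuspOrder



/-! ### Nonsingularity of the limit matrix `M₀` -/

section LimMat

variable {N : ℕ} [NeZero N]

local notation "𝕏" => SL(2, ℤ) ⧸ Gamma0 N

open scoped Classical

/-- Congruence for `coeffAt` in the width (which enters through a `NeZero` instance) and the
index. [folklore] -/
theorem coeffAt_congr {w₁ w₂ : ℕ} [NeZero w₁] [NeZero w₂] (hw : w₁ = w₂) {s₁ s₂ : ℕ} (hs : s₁ = s₂)
    (G : ℍ → ℂ) : coeffAt (w := w₁) s₁ G = coeffAt (w := w₂) s₂ G := by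
  subst hw hs
  rfl

/-- Congruence for `twistAvg` in the width and the index. [folklore] -/
theorem twistAvg_congr {w₁ w₂ : ℕ} [NeZero w₁] [NeZero w₂] (hw : w₁ = w₂) {s₁ s₂ : ℕ} (hs : s₁ = s₂)
    (G : ℍ → ℂ) : twistAvg w₁ s₁ G = twistAvg w₂ s₂ G := by
  subst hw hs
  rfl

variable {wt : Fin (gamma0Index N) → ℤ} {F : Fin (gamma0Index N) → ℍ → ℂ}

/-- The entries of `M₀` along the orbit of a base point: row `T^r · base x` carries the `r`-th
coefficients of the rows of `base x`. [folklore] -/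
theorem limMat_orbit (x : 𝕏) {r : ℕ} (hr : r < width N x) (j : Fin (gamma0Index N)) :
    limMat N wt F (cosetEquiv N (ModularGroup.T ^ r • base N x)) j =
      coeffAt (w := width N x) r (rowFun N wt F (base N x) j) := by
  unfold limMat
  rw [Equiv.symm_apply_apply, base_T_pow_smul, base_base]
  exact coeffAt_congr (by rw [width_T_pow_smul, width_base]) (off_T_pow_smul_base N x hr) _

omit [NeZero N] in
/-- Level-one multipliers with constant term `1`: for a common large even weight `M` there are
`m_j ∈ R_{M - k_j}` with `m_j → 1` at `i∞` (monomials in `E₄`, `E₆`). [folklore] -/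
theorem exists_multipliers (hwt : ∀ j, 0 ≤ wt j ∧ Even (wt j)) :
    ∃ (M : ℤ) (m : Fin (gamma0Index N) → ℍ → ℂ), (∀ j, m j ∈ levelOneSpace (M - wt j)) ∧
      ∀ j, Tendsto (m j) atImInfty (𝓝 1) := by
  have hT : ∀ j, wt j ≤ totalWeight N wt := fun j ↦ by
    unfold totalWeight
    exact Finset.single_le_sum (fun i _ ↦ (hwt i).1) (Finset.mem_univ j)
  have key : ∀ j, ∃ m : ℍ → ℂ, m ∈ levelOneSpace (2 * totalWeight N wt + 4 - wt j) ∧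
      Tendsto m atImInfty (𝓝 1) := by
    intro j
    obtain ⟨a, ha⟩ := (hwt j).2
    have h0 := (hwt j).1
    have hTj := hT j
    obtain ⟨n, hn⟩ : ∃ n : ℕ, 2 * totalWeight N wt + 4 - wt j = n :=
      ⟨(2 * totalWeight N wt + 4 - wt j).toNat, (Int.toNat_of_nonneg (by omega)).symm⟩
    have h4 : 4 ≤ n := by omega
    have heven : Even n := by
      rw [← Int.even_coe_nat, ← hn]
      exact ⟨totalWeight N wt + 2 - a, by omega⟩
    obtain ⟨m, -, hm, ht⟩ := exists_levelOne_tendsto_one h4 heven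
    exact ⟨m, hn ▸ hm, ht⟩
  choose m hm ht using key
  exact ⟨2 * totalWeight N wt + 4, m, hm, ht⟩

omit [NeZero N] in
/-- Conjugating a combination `∑ p_j F_j` with level-one coefficients conjugates the `F_j` only.
[folklore] -/
theorem cosetSlash_sum_levelOne_mul (hb : IsLevelOneBasis N wt F) {M : ℤ} {p : Fin (gamma0Index N) → ℍ → ℂ}
    (hp : ∀ j, p j ∈ levelOneSpace (M - wt j)) (hGmem : ∑ j, p j * F j ∈ gamma0Space N M) (x : 𝕏) :
    cosetSlash N M (∑ j, p j * F j) x = ∑ j, p j * rowFun N wt F x j := by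
  induction x using QuotientGroup.induction_on with
  | H g =>
    rw [cosetSlash_mk (slash_eq_of_mem_gamma0Space hGmem), sum_mul_slash_of_levelOne _ (fun j _ ↦ hp j)]
    refine Finset.sum_congr rfl fun j _ ↦ ?_
    rw [rowFun, cosetSlash_mk (slash_eq_of_mem_gamma0Space (hb.mem j))]

/-- Powers of `q_w` are bounded by `1` on `ℍ`. [folklore] -/
theorem norm_qParam_pow_le (w : ℕ) (r : ℕ) (τ : ℍ) : ‖Function.Periodic.qParam w τ ^ r‖ ≤ 1 := by
  rw [norm_pow]
  refine pow_le_one₀ (norm_nonneg _) ?_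
  rw [Function.Periodic.norm_qParam]
  refine Real.exp_le_one_iff.mpr ?_
  rcases Nat.eq_zero_or_pos w with h | h
  · simp [h]
  · have : 0 < τ.im := τ.im_pos
    have hw : (0 : ℝ) < w := by exact_mod_cast h
    rw [UpperHalfPlane.coe_im]
    have : 0 ≤ 2 * π * τ.im / w := by positivity
    have h' : -2 * π * τ.im / w = -(2 * π * τ.im / w) := by ring
    linarith

/-- **`M₀` is nonsingular**: if `∑_j M₀_{a,j} c_j = 0` for all rows `a`, then `c = 0`. Proof: with
level-one multipliers `m_j → 1` of weights `M - k_j`, the form `G = ∑ c_j m_j F_j ∈ A_M` has all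
projections `K_r(G ∣ b) → ∑_j c_j M₀ = 0`, so every conjugate of `G` is `O(e^{-2πy})`; hence
`G/Δ ∈ A_{M-12}`, and expanding `G/Δ = ∑ p'_j F_j` the uniqueness in the level-one basis gives
`c_j m_j = Δ p'_j`; at `i∞` the left side tends to `c_j`, the right side to `0`. [folklore] -/
theorem limMat_mulVec_eq_zero (hb : IsLevelOneBasis N wt F) (hwt : ∀ j, 0 ≤ wt j ∧ Even (wt j))
    {c : Fin (gamma0Index N) → ℂ} (hc : (limMat N wt F).mulVec c = 0) : c = 0 := by
  obtain ⟨M, m, hm, ht⟩ := exists_multipliers (N := N) (wt := wt) hwt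
  -- the test form `G = ∑ c_j m_j F_j`
  set p : Fin (gamma0Index N) → ℍ → ℂ := fun j ↦ c j • m j with hp
  have hpmem : ∀ j, p j ∈ levelOneSpace (M - wt j) := fun j ↦ Submodule.smul_mem _ _ (hm j)
  have hpt : ∀ j, Tendsto (p j) atImInfty (𝓝 (c j)) := fun j ↦ by
    rw [show p j = fun τ ↦ c j * m j τ from rfl]
    simpa using (ht j).const_mul (c j)
  set G : ℍ → ℂ := ∑ j, p j * F j with hG
  have hGmem : G ∈ gamma0Space N M := by
    refine Submodule.sum_mem _ fun j _ ↦ ?_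
    have := levelOne_mul_mem N (hpmem j) (hb.mem j)
    rwa [sub_add_cancel] at this
  have hslash : ∀ x : 𝕏, cosetSlash N M G x = ∑ j, p j * rowFun N wt F x j :=
    cosetSlash_sum_levelOne_mul hb hpmem hGmem
  have hperG : ∀ x : 𝕏, ∀ τ, cosetSlash N M G (base N x) ((ModularGroup.T ^ (width N x : ℤ)) • τ) =
      cosetSlash N M G (base N x) τ := fun x τ ↦ by
    have := cosetSlash_T_pow_width_smul hGmem (base N x) τ
    rwa [width_base] at this
  have hperF : ∀ x : 𝕏, ∀ j τ, rowFun N wt F (base N x) j ((ModularGroup.T ^ (width N x : ℤ)) • τ) =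
      rowFun N wt F (base N x) j τ := fun x j τ ↦ by
    have := rowFun_T_pow_width_smul hb (base N x) j τ
    rwa [width_base] at this
  -- Step 1: all projections of `G ∣ base x` decay
  have hcoef : ∀ x : 𝕏, ∀ r < width N x,
      twistAvg (width N x) r (cosetSlash N M G (base N x)) =O[atImInfty]
        fun τ : ℍ ↦ Real.exp (-2 * π * τ.im) := by
    intro x r hr
    refine isBigO_twistAvg_of_coeffAt_eq_zero hr (hperG x) (mdifferentiable_cosetSlash hGmem _)
      (isBoundedAtImInfty_cosetSlash hGmem _) ?_
    have hlim := tendsto_twistAvg hr (hperG x) (mdifferentiable_cosetSlash hGmem _)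
      (isBoundedAtImInfty_cosetSlash hGmem _)
    have hlim' : Tendsto (twistAvg (width N x) r (cosetSlash N M G (base N x))) atImInfty (𝓝 0) := by
      have heq : twistAvg (width N x) r (cosetSlash N M G (base N x)) =
          fun τ ↦ ∑ j, p j τ * twistAvg (width N x) r (rowFun N wt F (base N x) j) τ := by
        funext τ
        rw [hslash, twistAvg_sum_levelOne_mul _ _ _ (fun j _ ↦ hpmem j)]
      rw [heq]
      have hrow : ∀ j, Tendsto (fun τ ↦ p j τ * twistAvg (width N x) r (rowFun N wt F (base N x) j) τ)
          atImInfty (𝓝 (c j * coeffAt (w := width N x) r (rowFun N wt F (base N x) j))) := fun j ↦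
        (hpt j).mul (tendsto_twistAvg hr (hperF x j) (mdifferentiable_cosetSlash (hb.mem j) _)
          (isBoundedAtImInfty_cosetSlash (hb.mem j) _))
      have hsum := tendsto_finsetSum Finset.univ fun j _ ↦ hrow j
      have h0 : ∑ j, c j * coeffAt (w := width N x) r (rowFun N wt F (base N x) j) = 0 := by
        have := congr_fun hc (cosetEquiv N (ModularGroup.T ^ r • base N x))
        rw [Matrix.mulVec, dotProduct, Pi.zero_apply] at this
        rw [← this]
        refine Finset.sum_congr rfl fun j _ ↦ ?_
        rw [limMat_orbit x hr, mul_comm]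
      rwa [h0] at hsum
    exact tendsto_nhds_unique hlim hlim'
  -- Step 2: every conjugate of `G` decays
  have hdecay : ∀ y : 𝕏, cosetSlash N M G y =O[atImInfty] fun τ : ℍ ↦ Real.exp (-2 * π * τ.im) := by
    intro y
    have hy : cosetSlash N M G y = transl (-(off N y : ℤ)) (cosetSlash N M G (base N y)) := by
      rw [transl_cosetSlash hGmem, T_pow_off_smul_base]
    rw [hy]
    refine isBigO_transl _ ?_
    have heq : cosetSlash N M G (base N y) = fun τ : ℍ ↦ ∑ r ∈ Finset.range (width N y),
        Function.Periodic.qParam (width N y) τ ^ r * twistAvg (width N y) r (cosetSlash N M G (base N y)) τ := by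
      funext τ
      exact (sum_qParam_pow_mul_twistAvg y τ).symm
    rw [heq]
    refine IsBigO.sum fun r hr ↦ ?_
    have hq : (fun τ : ℍ ↦ Function.Periodic.qParam (width N y) τ ^ r) =O[atImInfty] fun _ : ℍ ↦ (1 : ℝ) :=
      IsBigO.of_bound 1 (Filter.Eventually.of_forall fun τ ↦ by
        rw [norm_one, mul_one]; exact norm_qParam_pow_le _ _ _)
    have := hq.mul (hcoef y r (Finset.mem_range.mp hr))
    simpa using this
  -- Step 3: `g = G/Δ ∈ A_{M-12}`
  set g : ℍ → ℂ := fun τ ↦ G τ / ModularForm.discriminant τ with hg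
  have hgmem : g ∈ gamma0Space N (M - 12) := by
    rw [mem_formSpace_iff]
    refine ⟨?_, ?_, ?_⟩
    · intro τ
      rw [UpperHalfPlane.mdifferentiableAt_iff]
      exact (UpperHalfPlane.mdifferentiableAt_iff.mp (mdifferentiable_of_mem_formSpace hGmem τ)).div
        (UpperHalfPlane.mdifferentiableAt_iff.mp (CuspForm.discriminant.holo' τ))
        (by simpa [ofComplex_apply] using discriminant_ne_zero τ)
    · rintro _ ⟨γ, hγ, rfl⟩
      show (fun τ ↦ G τ / ModularForm.discriminant τ) ∣[M - 12] (γ : GL (Fin 2) ℝ) = _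
      rw [div_discriminant_slash, slash_eq_of_mem_gamma0Space hGmem γ hγ]
    · intro g'
      show IsBoundedAtImInfty ((fun τ ↦ G τ / ModularForm.discriminant τ) ∣[M - 12] (g' : GL (Fin 2) ℝ))
      rw [div_discriminant_slash]
      have : G ∣[M] (g' : GL (Fin 2) ℝ) = cosetSlash N M G ((g'⁻¹ : SL(2, ℤ)) : 𝕏) := by
        rw [cosetSlash_mk (slash_eq_of_mem_gamma0Space hGmem), inv_inv]
      rw [this]
      exact isBoundedAtImInfty_div_discriminant (hdecay _)
  -- Step 4: compare the two expansions of `G`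
  obtain ⟨p', hp'mem, hp'eq⟩ := hb.span (M - 12) g hgmem
  have hΔmem : (ModularForm.discriminant : ℍ → ℂ) ∈ levelOneSpace 12 :=
    coe_mem_formSpace (CuspForm.discriminant : ModularForm 𝒮ℒ 12)
  have hcoefmem : ∀ j, p j - ModularForm.discriminant * p' j ∈ levelOneSpace (M - wt j) := by
    intro j
    refine Submodule.sub_mem _ (hpmem j) ?_
    have := mul_mem_formSpace hΔmem (hp'mem j)
    rwa [show (12 : ℤ) + (M - 12 - wt j) = M - wt j by ring] at this
  have hrel : ∑ j, (p j - ModularForm.discriminant * p' j) * F j = 0 := by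
    have h1 : ∀ τ, ModularForm.discriminant τ * g τ = G τ := fun τ ↦ by
      rw [hg]
      exact mul_div_cancel₀ _ (discriminant_ne_zero τ)
    funext τ
    have h2 := h1 τ
    rw [hp'eq] at h2
    simp only [Finset.sum_apply, Pi.mul_apply, Finset.mul_sum] at h2
    have h3 : G τ = ∑ j, p j τ * F j τ := by simp [hG, Finset.sum_apply]
    simp only [Finset.sum_apply, Pi.mul_apply, Pi.sub_apply, Pi.zero_apply, sub_mul,
      Finset.sum_sub_distrib]
    rw [← h3, ← h2]
    simp only [mul_assoc, sub_self]
  have hzero := hb.indep M _ hcoefmem hrel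
  -- Step 5: constant terms
  funext j
  rw [Pi.zero_apply]
  have hbd : IsBoundedAtImInfty (p' j) := by
    have := isBoundedAtImInfty_slash_of_mem_formSpace (hp'mem j) 1
    simpa using this
  have h0 : (ModularForm.discriminant : ℍ → ℂ) =o[atImInfty] (fun _ : ℍ ↦ (1 : ℝ)) :=
    (Asymptotics.isLittleO_one_iff ℝ).mpr discriminant_isZeroAtImInfty
  have hlim0 : Tendsto (fun τ ↦ ModularForm.discriminant τ * p' j τ) atImInfty (𝓝 0) := by
    have := h0.mul_isBigO hbd
    simp only [Pi.one_apply, mul_one] at this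
    exact (Asymptotics.isLittleO_one_iff ℝ).mp this
  have heq : p j = fun τ ↦ ModularForm.discriminant τ * p' j τ := by
    have := hzero j
    rw [sub_eq_zero] at this
    rw [this]
    rfl
  exact tendsto_nhds_unique (heq ▸ hpt j) hlim0

end LimMat


/-! ### The cusp order of `𝒟`: `∑ k_j = 12 t`, and `2t = μ - ν_∞` -/

section CuspWeight

variable {N : ℕ} [NeZero N]

local notation "𝕏" => SL(2, ℤ) ⧸ Gamma0 N

open scoped Classical

variable {wt : Fin (gamma0Index N) → ℤ} {F : Fin (gamma0Index N) → ℍ → ℂ}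

/-- `det M₀ ≠ 0`. [folklore] -/
theorem det_limMat_ne_zero (hb : IsLevelOneBasis N wt F) (hwt : ∀ j, 0 ≤ wt j ∧ Even (wt j)) :
    (limMat N wt F).det ≠ 0 := by
  intro h
  obtain ⟨v, hv, hMv⟩ := Matrix.exists_mulVec_eq_zero_iff.mpr h
  exact hv (limMat_mulVec_eq_zero hb hwt hMv)

/-- **Exact decay rate of `𝒟` at `i∞`**: `‖𝒟(τ)‖ e^{2π t Im τ} → ‖det M₀‖/‖det L‖ > 0`, from
`L · Φ = diag(q_w^{off}) · H`, `H → M₀`. [folklore] -/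
theorem tendsto_norm_basisDet_mul_exp (hb : IsLevelOneBasis N wt F) (hwt : ∀ j, 0 ≤ wt j ∧ Even (wt j)) :
    ∃ A : ℝ, 0 < A ∧ Tendsto (fun τ : ℍ ↦ ‖basisDet N wt F τ‖ * Real.exp (2 * π * cuspExp N * τ.im))
      atImInfty (𝓝 A) := by
  have hL := det_dftMat_ne_zero (N := N)
  have hM := det_limMat_ne_zero hb hwt
  refine ⟨‖(limMat N wt F).det‖ / ‖(dftMat N).det‖,
    div_pos (norm_pos_iff.mpr hM) (norm_pos_iff.mpr hL), ?_⟩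
  have key : ∀ τ : ℍ, ‖basisDet N wt F τ‖ * Real.exp (2 * π * cuspExp N * τ.im) =
      ‖(coefMat N wt F τ).det‖ / ‖(dftMat N).det‖ := by
    intro τ
    have h1 : (dftMat N).det * basisDet N wt F τ = (∏ a, qFactor N a τ) * (coefMat N wt F τ).det := by
      rw [basisDet, ← Matrix.det_mul, ← projMat_eq_mul, det_projMat hb]
    have h2 := congrArg norm h1
    rw [norm_mul, norm_mul, norm_prod_qFactor] at h2
    rw [eq_div_iff (norm_ne_zero_iff.mpr hL)]
    have hexp : Real.exp (-2 * π * cuspExp N * τ.im) * Real.exp (2 * π * cuspExp N * τ.im) = 1 := by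
      rw [← Real.exp_add]
      convert Real.exp_zero using 2
      ring
    calc ‖basisDet N wt F τ‖ * Real.exp (2 * π * cuspExp N * τ.im) * ‖(dftMat N).det‖
        = (‖(dftMat N).det‖ * ‖basisDet N wt F τ‖) * Real.exp (2 * π * cuspExp N * τ.im) := by ring
      _ = Real.exp (-2 * π * cuspExp N * τ.im) * ‖(coefMat N wt F τ).det‖ *
            Real.exp (2 * π * cuspExp N * τ.im) := by rw [h2]
      _ = ‖(coefMat N wt F τ).det‖ := by
          rw [mul_comm (Real.exp _), mul_assoc, hexp, mul_one]
  simp_rw [key]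
  exact ((tendsto_det_coefMat hb).norm).div_const _

/-- **`K = ∑ k_j = 12 t`**: comparing `‖𝒟‖¹² e^{2πKy} → C > 0` (`𝒟¹² = cΔ^K`) with
`‖𝒟‖ e^{2πty} → A > 0` forces `e^{2π(K - 12t)y}` to converge to a positive real, so `K = 12t`.
[cite: Gannon2014, Thm. 3.4(b)] -/
theorem totalWeight_eq_twelve_mul_cuspExp (hb : IsLevelOneBasis N wt F) (hwt : ∀ j, 0 ≤ wt j ∧ Even (wt j)) :
    (totalWeight N wt : ℝ) = 12 * cuspExp N := by
  have hK : 0 ≤ totalWeight N wt := totalWeight_nonneg hwt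
  obtain ⟨C, hC, hCt⟩ := tendsto_norm_basisDet_pow hb hK
  obtain ⟨A, hA, hAt⟩ := tendsto_norm_basisDet_mul_exp hb hwt
  set s : ℝ := (totalWeight N wt : ℝ) - 12 * cuspExp N with hs
  have hKnat : ((totalWeight N wt).toNat : ℝ) = (totalWeight N wt : ℝ) := by
    exact_mod_cast Int.toNat_of_nonneg hK
  -- `e^{2π s y} → C / A¹²`
  have hq : Tendsto (fun τ : ℍ ↦ Real.exp (2 * π * s * τ.im)) atImInfty (𝓝 (C / A ^ 12)) := by
    have h := hCt.div (hAt.pow 12) (pow_ne_zero _ hA.ne')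
    refine h.congr' (Filter.Eventually.of_forall fun τ ↦ ?_)
    have hD : 0 < ‖basisDet N wt F τ‖ := norm_pos_iff.mpr (basisDet_ne_zero hb hK τ)
    simp only [Pi.div_apply]
    rw [hKnat, mul_pow, ← Real.exp_nat_mul, mul_div_mul_left _ _ (pow_ne_zero 12 hD.ne'),
      ← Real.exp_sub, hs]
    congr 1
    push_cast
    ring
  have him : Tendsto (fun τ : ℍ ↦ τ.im) atImInfty atTop := by
    rw [atImInfty]
    exact Filter.tendsto_comap
  rcases lt_trichotomy s 0 with hneg | h0 | hpos
  · have h0' : Tendsto (fun τ : ℍ ↦ Real.exp (2 * π * s * τ.im)) atImInfty (𝓝 0) := by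
      refine Real.tendsto_exp_atBot.comp ?_
      have : Tendsto (fun y : ℝ ↦ 2 * π * s * y) atTop atBot :=
        Tendsto.const_mul_atTop_of_neg (by nlinarith [Real.pi_pos]) tendsto_id
      exact this.comp him
    have := tendsto_nhds_unique hq h0'
    exact absurd this (div_pos hC (pow_pos hA 12)).ne'
  · linarith
  · have h0' : Tendsto (fun τ : ℍ ↦ Real.exp (2 * π * s * τ.im)) atImInfty atTop := by
      refine Real.tendsto_exp_atTop.comp ?_
      have : Tendsto (fun y : ℝ ↦ 2 * π * s * y) atTop atTop :=
        Tendsto.const_mul_atTop (by positivity) tendsto_id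
      exact this.comp him
    exact absurd hq (not_tendsto_nhds_of_tendsto_atTop h0' _)

/-! #### Counting: `2t = μ - #(base points)` and `#(base points) = ν_∞` -/

/-- The local `Fintype` structure on the coset space. [folklore] -/
local instance fintypeCosetCuspWeight : Fintype (SL(2, ℤ) ⧸ Gamma0 N) := Fintype.ofFinite _

variable (N) in
/-- The finset of base points (one per `T`-orbit, i.e. per cusp). [folklore] -/
def basePoints : Finset 𝕏 := Finset.univ.filter fun x ↦ base N x = x

/-- `base x` is a base point. [folklore] -/
theorem base_mem_basePoints (x : 𝕏) : base N x ∈ basePoints N :=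
  Finset.mem_filter.mpr ⟨Finset.mem_univ _, base_base N x⟩

/-- The fibre of `base` over a base point `b` is the orbit finset of `b`. [folklore] -/
theorem filter_base_eq (b : 𝕏) (hb : base N b = b) :
    (Finset.univ.filter fun x : 𝕏 ↦ base N x = b) = orbitFin N b := by
  ext x
  simp only [Finset.mem_filter, Finset.mem_univ, true_and]
  constructor
  · intro hx
    rw [← hx]
    exact (mem_orbitFin' N).mpr ⟨off N x, T_pow_off_smul_base N x⟩
  · intro hx
    rw [base_eq_of_mem N hx, hb]

omit [NeZero N] in
/-- A sum over the orbit of a base point is a sum over exponents `i < w`. [folklore] -/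
theorem sum_orbitFin_eq {M : Type*} [AddCommMonoid M] (b : 𝕏) (f : 𝕏 → M) :
    ∑ x ∈ orbitFin N b, f x = ∑ i ∈ Finset.range (width N b), f (ModularGroup.T ^ i • b) := by
  rw [orbitFin, Finset.sum_image]
  intro i hi i' hi' h
  exact T_pow_smul_injOn N b (Finset.mem_range.mp hi) (Finset.mem_range.mp hi') h

/-- `∑_{x} off(x)/w(x)` over the orbit of a base point `b` is `(w(b) - 1)/2`. [folklore] -/
theorem sum_orbit_off_div_width (b : 𝕏) (hb : base N b = b) :
    ∑ x ∈ orbitFin N b, (off N x : ℝ) / width N x = ((width N b : ℝ) - 1) / 2 := by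
  rw [sum_orbitFin_eq]
  have h : ∀ i ∈ Finset.range (width N b), (off N (ModularGroup.T ^ i • b) : ℝ) / width N (ModularGroup.T ^ i • b) =
      (i : ℝ) / width N b := by
    intro i hi
    have hoff := off_T_pow_smul_base N b (Finset.mem_range.mp hi)
    rw [hb] at hoff
    rw [width_T_pow_smul, hoff]
  rw [Finset.sum_congr rfl h, ← Finset.sum_div]
  have hw : (0 : ℝ) < width N b := by exact_mod_cast width_pos N b
  rw [div_eq_div_iff hw.ne' two_ne_zero]
  have hg := Finset.sum_range_id_mul_two (width N b)
  have hcast : (∑ i ∈ Finset.range (width N b), (i : ℝ)) * 2 = (width N b : ℝ) * ((width N b : ℝ) - 1) := by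
    have := congrArg (Nat.cast (R := ℝ)) hg
    push_cast [Nat.cast_sub (width_pos N b)] at this
    exact this
  linarith

/-- Powers `Tⁿ`, `n ∈ ℤ`, act on cosets like powers with exponents in `ℕ`. [folklore] -/
theorem exists_T_zpow_smul_eq (y : 𝕏) (n : ℤ) :
    ∃ i : ℕ, (ModularGroup.T ^ n) • y = ModularGroup.T ^ i • y := by
  refine ⟨(n % N).toNat, ?_⟩
  have hN : (N : ℤ) ≠ 0 := by exact_mod_cast NeZero.ne N
  have hmod : 0 ≤ n % N := Int.emod_nonneg _ hN
  have hfix : ∀ m : ℤ, (ModularGroup.T ^ ((N : ℤ) * m)) • y = y := by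
    intro m
    rw [zpow_mul, zpow_natCast]
    have hmem : ModularGroup.T ^ N ∈ MulAction.stabilizer SL(2, ℤ) y := T_pow_N_smul N y
    exact (MulAction.stabilizer SL(2, ℤ) y).zpow_mem hmem m
  conv_lhs => rw [← Int.emod_add_mul_ediv n N]
  rw [zpow_add, mul_smul, hfix, ← zpow_natCast, Int.toNat_of_nonneg hmod]

/-- `base (Tⁿ x) = base x` for `n ∈ ℤ`. [folklore] -/
theorem base_T_zpow_smul (y : 𝕏) (n : ℤ) : base N ((ModularGroup.T ^ n) • y) = base N y := by
  obtain ⟨i, hi⟩ := exists_T_zpow_smul_eq y n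
  rw [hi, base_T_pow_smul]

/-- `base x` lies in the `⟨T⟩`-orbit class of `x`: `T^{-off x} x = base x`. [folklore] -/
theorem T_zpow_neg_off_smul (x : 𝕏) : (ModularGroup.T ^ (-(off N x : ℤ))) • x = base N x := by
  rw [zpow_neg, inv_smul_eq_iff, zpow_natCast, T_pow_off_smul_base]

variable (N) in
/-- **Base points `≃` `T`-orbits** (`= cusps`). [folklore] -/
def basePointsEquiv :
    MulAction.orbitRel.Quotient (Subgroup.zpowers (ModularGroup.T : SL(2, ℤ))) 𝕏 ≃ {x // x ∈ basePoints N} where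
  toFun := Quotient.lift (fun x ↦ (⟨base N x, base_mem_basePoints x⟩ : {x // x ∈ basePoints N})) (by
    intro x y hxy
    obtain ⟨⟨g, hg⟩, hgy⟩ := MulAction.orbitRel_apply.mp hxy
    obtain ⟨n, rfl⟩ := Subgroup.mem_zpowers_iff.mp hg
    refine Subtype.ext ?_
    simp only
    rw [← hgy]
    exact base_T_zpow_smul y n)
  invFun x := Quotient.mk _ x.1
  left_inv q := Quotient.inductionOn q fun x ↦ Quotient.sound (MulAction.orbitRel_apply.mpr
    ⟨⟨ModularGroup.T ^ (-(off N x : ℤ)), Subgroup.mem_zpowers_iff.mpr ⟨_, rfl⟩⟩, T_zpow_neg_off_smul x⟩)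
  right_inv x := Subtype.ext (Finset.mem_filter.mp x.2).2

/-- **`#(base points) = ν_∞`** (tree `card_orbits_T_eq_nuInfty`). [folklore] -/
theorem card_basePoints : (basePoints N).card = nuInfty N := by
  rw [← card_orbits_T_eq_nuInfty N, Nat.card_congr (basePointsEquiv N), Nat.card_eq_finsetCard]

/-- **`2t = μ - ν_∞`**: on each orbit the offsets are `0, …, w - 1`, contributing `(w-1)/2`, and
`∑ w = μ`. [folklore] -/
theorem two_mul_cuspExp : 2 * cuspExp N = gamma0Index N - nuInfty N := by
  unfold cuspExp
  have h1 : ∑ a : Fin (gamma0Index N), (off N ((cosetEquiv N).symm a) : ℝ) / width N ((cosetEquiv N).symm a) =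
      ∑ x : 𝕏, (off N x : ℝ) / width N x :=
    Equiv.sum_comp (cosetEquiv N).symm (fun x ↦ (off N x : ℝ) / width N x)
  rw [h1, ← Finset.sum_fiberwise_of_maps_to (s := Finset.univ) (t := basePoints N) (g := base N)
    (fun x _ ↦ base_mem_basePoints x)]
  have h2 : ∀ b ∈ basePoints N, ∑ x ∈ Finset.univ.filter (fun x : 𝕏 ↦ base N x = b),
      (off N x : ℝ) / width N x = ((width N b : ℝ) - 1) / 2 := by
    intro b hb
    have hb' : base N b = b := (Finset.mem_filter.mp hb).2
    rw [filter_base_eq b hb', sum_orbit_off_div_width b hb']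
  rw [Finset.sum_congr rfl h2, ← Finset.sum_div]
  have h3 : ∑ b ∈ basePoints N, (width N b : ℝ) = gamma0Index N := by
    have hc := Finset.card_eq_sum_card_fiberwise (s := (Finset.univ : Finset 𝕏)) (t := basePoints N)
      (f := base N) (fun x _ ↦ base_mem_basePoints x)
    have hfib : ∀ b ∈ basePoints N, (Finset.univ.filter (fun x : 𝕏 ↦ base N x = b)).card = width N b :=
      fun b hb ↦ by rw [filter_base_eq b (Finset.mem_filter.mp hb).2, card_orbitFin]
    have : (Finset.univ : Finset 𝕏).card = ∑ b ∈ basePoints N, width N b := by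
      rw [hc]
      exact Finset.sum_congr rfl hfib
    rw [Finset.card_univ, ← Nat.card_eq_fintype_card, card_coset_eq_gamma0Index] at this
    exact_mod_cast this.symm
  rw [Finset.sum_sub_distrib, h3, Finset.sum_const, nsmul_eq_mul, mul_one, card_basePoints]
  ring

/-- **The cusp constraint on the weights**: `∑_j k_j = 6(μ - ν_∞)`. [cite: Gannon2014, Thm. 3.4(b)] -/
theorem totalWeight_eq (hb : IsLevelOneBasis N wt F) (hwt : ∀ j, 0 ≤ wt j ∧ Even (wt j)) :
    totalWeight N wt + 6 * nuInfty N = 6 * gamma0Index N := by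
  have h1 := totalWeight_eq_twelve_mul_cuspExp hb hwt
  have h2 := two_mul_cuspExp (N := N)
  have h3 : (totalWeight N wt : ℝ) + 6 * nuInfty N = 6 * gamma0Index N := by linarith
  exact_mod_cast h3

end CuspWeight



/-! ### Bookkeeping: `dim M₂(Γ₀(N)) = #{j : k_j = 2} ≥ g - 1 + ν_∞` -/

section Bookkeeping

variable {N : ℕ} [NeZero N]
variable {wt : Fin (gamma0Index N) → ℤ} {F : Fin (gamma0Index N) → ℍ → ℂ}

omit [NeZero N] in
/-- The per-generator weight inequality: for even `k ≥ 0`,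
`6[k ≡ 2 (4)] + 8[k ≡ 2 (6)] + 4[k ≡ 4 (6)] ≤ k + 12[k = 2]`. [folklore] -/
theorem weight_ineq {k : ℤ} (h0 : 0 ≤ k) (he : Even k) :
    6 * (if ¬ (4 : ℤ) ∣ k then (1 : ℤ) else 0) + 8 * (if k % 6 = 2 then (1 : ℤ) else 0) +
        4 * (if k % 6 = 4 then (1 : ℤ) else 0) ≤ k + 12 * (if k = 2 then (1 : ℤ) else 0) := by
  obtain ⟨a, rfl⟩ := he
  split_ifs <;> omega

/-- **`12 · #{j : k_j = 2} ≥ 12(g - 1 + ν_∞)`**: sum the per-generator inequality and insert the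
elliptic counts `2#{k ≢ 0 (4)} + ν₂ = μ`, `3#{k ≡ 2 (6)} + ν₃ = μ = 3#{k ≡ 4 (6)} + ν₃`, the cusp
count `∑ k_j + 6ν_∞ = 6μ` and `12g + 3ν₂ + 4ν₃ + 6ν_∞ = 12 + μ`. [cite: Gannon2014, §3.5] -/
theorem twelve_mul_genusX0_add_le_card_wt_two (hb : IsLevelOneBasis N wt F) (hwt : ∀ j, 0 ≤ wt j ∧ Even (wt j))
    (hK : totalWeight N wt + 6 * nuInfty N = 6 * gamma0Index N) :
    12 * genusX0 N + 12 * nuInfty N ≤ 12 * (Finset.univ.filter fun j ↦ wt j = 2).card + 12 := by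
  have h4 := (two_mul_card_four_dvd hb hwt).2
  obtain ⟨-, h62, h64⟩ := three_mul_card_six_dvd hb hwt
  have hg := twelve_mul_genusX0_holds N
  unfold twelve_mul_genusX0 at hg
  have hsum : 6 * ((Finset.univ.filter fun j ↦ ¬ (4 : ℤ) ∣ wt j).card : ℤ) +
      8 * ((Finset.univ.filter fun j ↦ wt j % 6 = 2).card : ℤ) +
      4 * ((Finset.univ.filter fun j ↦ wt j % 6 = 4).card : ℤ) ≤
      totalWeight N wt + 12 * ((Finset.univ.filter fun j ↦ wt j = 2).card : ℤ) := by
    have := Finset.sum_le_sum fun j (_ : j ∈ (Finset.univ : Finset (Fin (gamma0Index N)))) ↦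
      weight_ineq (hwt j).1 (hwt j).2
    simp only [Finset.sum_add_distrib, ← Finset.mul_sum, Finset.sum_boole] at this
    unfold totalWeight
    exact_mod_cast this
  omega

omit [NeZero N] in
/-- `dim R₀ = 1`. [folklore] -/
theorem finrank_levelOneSpace_zero : Module.finrank ℂ (levelOneSpace 0) = 1 := by
  rw [finrank_formSpace]
  have h := ModularForm.dimension_level_one 0 (by decide)
  have h12 : ¬ (0 ≡ 2 [MOD 12]) := by decide
  rw [if_neg h12] at h
  have : Module.finrank ℂ (ModularForm 𝒮ℒ ((0 : ℕ) : ℤ)) = 1 :=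
    Module.finrank_eq_of_rank_eq (by rw [h])
  simpa using this

omit [NeZero N] in
/-- `dim R₂ = 0`. [folklore] -/
theorem finrank_levelOneSpace_two : Module.finrank ℂ (levelOneSpace 2) = 0 := by
  rw [finrank_formSpace]
  exact Module.finrank_eq_of_rank_eq (by rw [ModularForm.levelOne_weight_two_rank_zero]; simp)

/-- **`dim M₂(Γ₀(N)) = #{j : k_j = 2}`** (`R₀ = ℂ`, `R₂ = 0`, `R_{<0} = 0`). [folklore] -/
theorem finrank_gamma0Space_two (hb : IsLevelOneBasis N wt F) (hwt : ∀ j, 0 ≤ wt j ∧ Even (wt j)) :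
    Module.finrank ℂ (gamma0Space N 2) = (Finset.univ.filter fun j ↦ wt j = 2).card := by
  rw [hb.finrank_eq 2, Finset.card_eq_sum_ones, Finset.sum_filter]
  refine Finset.sum_congr rfl fun j _ ↦ ?_
  split_ifs with h2
  · rw [h2, show (2 : ℤ) - 2 = 0 by norm_num]
    exact finrank_levelOneSpace_zero
  · rcases eq_or_lt_of_le (hwt j).1 with h0 | hpos
    · rw [← h0, sub_zero]
      exact finrank_levelOneSpace_two
    · have h4 : 4 ≤ wt j := by
        obtain ⟨a, ha⟩ := (hwt j).2
        omega
      rw [show levelOneSpace (2 - wt j) = ⊥ from formSpace_eq_bot_of_neg (by omega), finrank_bot]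

end Bookkeeping

/-! ### The residue relation: `dim S₂(Γ₀(N)) ≥ dim M₂(Γ₀(N)) - (ν_∞ - 1)` -/

section Residue

variable {N : ℕ} [NeZero N]

local notation "𝕏" => SL(2, ℤ) ⧸ Gamma0 N

open scoped Classical

/-- The local `Fintype` structure on the coset space. [folklore] -/
local instance fintypeCosetResidue : Fintype (SL(2, ℤ) ⧸ Gamma0 N) := Fintype.ofFinite _

omit [NeZero N] in
/-- A `w`-periodic bounded holomorphic function on `ℍ` tends to its `valueAtInfty` at `i∞`.
[folklore] -/
theorem tendsto_valueAtInfty_of_periodic {G : ℍ → ℂ} {w : ℕ} (hw : 0 < w)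
    (hper : ∀ τ, G ((ModularGroup.T ^ (w : ℤ)) • τ) = G τ) (hhol : MDiff G) (hbdd : IsBoundedAtImInfty G) :
    Tendsto G atImInfty (𝓝 (valueAtInfty G)) := by
  have hper' : Function.Periodic (G ∘ ofComplex) (w : ℝ) := by
    have h : G ∣[(0 : ℤ)] ((ModularGroup.T ^ (w : ℤ) : SL(2, ℤ)) : GL (Fin 2) ℝ) = G := by
      rw [slash_T_zpow_eq_transl]
      funext τ
      exact hper τ
    have := periodic_comp_ofComplex_of_slash_T_zpow h
    simpa using this
  have hw' : (0 : ℝ) < w := by exact_mod_cast hw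
  have hanal := analyticAt_cuspFunction_zero hw' hper' hhol hbdd
  rw [← cuspFunction_apply_zero hw' hanal hper']
  have heq : (cuspFunction w G ∘ fun τ : ℍ ↦ Function.Periodic.qParam w τ) = G :=
    funext fun τ ↦ by simpa using eq_cuspFunction τ hw'.ne' hper'
  simpa [heq] using hanal.continuousAt.tendsto.comp (qParam_tendsto_atImInfty hw')

/-- Conjugates of `Γ₀(N)`-forms tend to their value at `i∞`. [folklore] -/
theorem tendsto_cosetSlash {k : ℤ} {f : ℍ → ℂ} (hf : f ∈ gamma0Space N k) (x : 𝕏) :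
    Tendsto (cosetSlash N k f x) atImInfty (𝓝 (valueAtInfty (cosetSlash N k f x))) :=
  tendsto_valueAtInfty_of_periodic (width_pos N x) (cosetSlash_T_pow_width_smul hf x)
    (mdifferentiable_cosetSlash hf x) (isBoundedAtImInfty_cosetSlash hf x)

omit [NeZero N] in
/-- `τ ↦ Tⁿτ` preserves `i∞`. [folklore] -/
theorem tendsto_T_zpow_smul_atImInfty (n : ℤ) :
    Tendsto (fun τ : ℍ ↦ (ModularGroup.T ^ n) • τ) atImInfty atImInfty := by
  rw [atImInfty, Filter.tendsto_comap_iff]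
  have : UpperHalfPlane.im ∘ (fun τ : ℍ ↦ (ModularGroup.T ^ n) • τ) = UpperHalfPlane.im := by
    funext τ
    exact (coe_T_zpow_smul n τ).2
  rw [this]
  exact Filter.tendsto_comap

/-- The value at `i∞` is constant along `T`-orbits: `v(f ∣ x) = v(f ∣ base x)`. [folklore] -/
theorem valueAtInfty_cosetSlash_eq_base {k : ℤ} {f : ℍ → ℂ} (hf : f ∈ gamma0Space N k) (x : 𝕏) :
    valueAtInfty (cosetSlash N k f x) = valueAtInfty (cosetSlash N k f (base N x)) := by
  have hx : cosetSlash N k f x = transl (-(off N x : ℤ)) (cosetSlash N k f (base N x)) := by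
    rw [transl_cosetSlash hf, T_pow_off_smul_base]
  rw [hx]
  exact ((tendsto_cosetSlash hf (base N x)).comp (tendsto_T_zpow_smul_atImInfty _)).limUnder_eq

omit [NeZero N] in
/-- Finite sums of functions bounded at `i∞` are bounded at `i∞`. [folklore] -/
theorem isBoundedAtImInfty_sum {ι : Type*} (s : Finset ι) {g : ι → ℍ → ℂ}
    (h : ∀ i ∈ s, IsBoundedAtImInfty (g i)) : IsBoundedAtImInfty (∑ i ∈ s, g i) := by
  induction s using Finset.induction_on with
  | empty => simpa using (UpperHalfPlane.zero_form_isBoundedAtImInfty : IsBoundedAtImInfty (0 : ℍ → ℂ))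
  | insert i t hi ih =>
    rw [Finset.sum_insert hi]
    exact (h i (Finset.mem_insert_self i t)).add (ih fun j hj ↦ h j (Finset.mem_insert_of_mem hj))

/-- **The trace to level one vanishes in weight `2`**: `∑_x f ∣ x ∈ M₂(SL₂(ℤ)) = 0`. [folklore] -/
theorem sum_cosetSlash_eq_zero {f : ℍ → ℂ} (hf : f ∈ gamma0Space N 2) :
    ∑ x : 𝕏, cosetSlash N 2 f x = 0 := by
  have hF := slash_eq_of_mem_gamma0Space hf
  have hinv : ∀ g : SL(2, ℤ), (∑ x : 𝕏, cosetSlash N 2 f x) ∣[(2 : ℤ)] (g : GL (Fin 2) ℝ) =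
      ∑ x : 𝕏, cosetSlash N 2 f x := by
    intro g
    rw [SlashAction.sum_slash]
    simp_rw [cosetSlash_slash hF]
    exact Equiv.sum_comp (MulAction.toPerm (g⁻¹ : SL(2, ℤ))) (fun x ↦ cosetSlash N 2 f x)
  have hmem : (∑ x : 𝕏, cosetSlash N 2 f x) ∈ levelOneSpace 2 := by
    rw [mem_formSpace_iff]
    refine ⟨?_, ?_, fun g ↦ ?_⟩
    · have := mdifferentiable_finset_sum (Finset.univ : Finset 𝕏) (f := fun x ↦ cosetSlash N 2 f x)
        fun x _ ↦ mdifferentiable_cosetSlash hf x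
      exact this
    · rintro _ ⟨g, rfl⟩
      exact hinv g
    · rw [hinv g]
      exact isBoundedAtImInfty_sum _ fun x _ ↦ isBoundedAtImInfty_cosetSlash hf x
  obtain ⟨Q, hQ⟩ := hmem
  rw [← hQ, rank_zero_iff_forall_zero.mp ModularForm.levelOne_weight_two_rank_zero Q]
  rfl

/-- **The residue relation**: `∑_x v(f ∣ x) = 0` for `f ∈ M₂(Γ₀(N))`. [folklore] -/
theorem sum_valueAtInfty_eq_zero {f : ℍ → ℂ} (hf : f ∈ gamma0Space N 2) :
    ∑ x : 𝕏, valueAtInfty (cosetSlash N 2 f x) = 0 := by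
  have h1 : Tendsto (fun τ ↦ ∑ x : 𝕏, cosetSlash N 2 f x τ) atImInfty
      (𝓝 (∑ x : 𝕏, valueAtInfty (cosetSlash N 2 f x))) :=
    tendsto_finsetSum _ fun x _ ↦ tendsto_cosetSlash hf x
  have h2 : (fun τ ↦ ∑ x : 𝕏, cosetSlash N 2 f x τ) = 0 := by
    funext τ
    have := congr_fun (sum_cosetSlash_eq_zero hf) τ
    simpa [Finset.sum_apply] using this
  rw [h2] at h1
  exact (tendsto_nhds_unique tendsto_const_nhds h1).symm ▸ rfl

/-- The residue relation over the cusps: `∑_{b base point} w(b) · v(f ∣ b) = 0`. [folklore] -/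
theorem sum_width_mul_valueAtInfty_eq_zero {f : ℍ → ℂ} (hf : f ∈ gamma0Space N 2) :
    ∑ b ∈ basePoints N, (width N b : ℂ) * valueAtInfty (cosetSlash N 2 f b) = 0 := by
  rw [← sum_valueAtInfty_eq_zero hf, ← Finset.sum_fiberwise_of_maps_to (s := Finset.univ)
    (t := basePoints N) (g := base N) (fun x _ ↦ base_mem_basePoints x)]
  refine Finset.sum_congr rfl fun b hb ↦ ?_
  have hb' : base N b = b := (Finset.mem_filter.mp hb).2
  rw [Finset.sum_congr rfl fun x (hx : x ∈ Finset.univ.filter fun x ↦ base N x = b) ↦ by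
    rw [valueAtInfty_cosetSlash_eq_base hf x, (Finset.mem_filter.mp hx).2]]
  rw [Finset.sum_const, nsmul_eq_mul, filter_base_eq b hb', card_orbitFin]

variable (N) in
/-- The **cusp-value functional** `f ↦ v(f ∣ x)` on `M₂(Γ₀(N))`. [folklore] -/
def cuspValue (x : 𝕏) : gamma0Space N 2 →ₗ[ℂ] ℂ where
  toFun f := valueAtInfty (cosetSlash N 2 (f : ℍ → ℂ) x)
  map_add' f g := by
    have hadd : cosetSlash N 2 ((f : ℍ → ℂ) + g) x = cosetSlash N 2 (f : ℍ → ℂ) x + cosetSlash N 2 (g : ℍ → ℂ) x :=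
      SlashAction.add_slash _ _ _ _
    simp only [Submodule.coe_add]
    rw [hadd]
    exact ((tendsto_cosetSlash f.2 x).add (tendsto_cosetSlash g.2 x)).limUnder_eq
  map_smul' c f := by
    have hsmul : cosetSlash N 2 (c • (f : ℍ → ℂ)) x = c • cosetSlash N 2 (f : ℍ → ℂ) x := by
      unfold cosetSlash
      rw [← ModularForm.SL_slash, ModularForm.SL_smul_slash, ModularForm.SL_slash]
    simp only [Submodule.coe_smul, RingHom.id_apply]
    rw [hsmul]
    exact ((tendsto_cosetSlash f.2 x).const_smul c).limUnder_eq

/-- `cuspValue` unfolded. [folklore] -/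
theorem cuspValue_apply (x : 𝕏) (f : gamma0Space N 2) :
    cuspValue N x f = valueAtInfty (cosetSlash N 2 (f : ℍ → ℂ) x) := rfl

variable (N) in
/-- The cusp-value map `M₂(Γ₀(N)) → ℂ^{base points}`. [folklore] -/
def cuspValues : gamma0Space N 2 →ₗ[ℂ] ({x // x ∈ basePoints N} → ℂ) :=
  LinearMap.pi fun b ↦ cuspValue N b.1

variable (N) in
/-- The weighted-sum functional `v ↦ ∑_b w(b) v_b` on `ℂ^{base points}`. [folklore] -/
def widthSum : ({x // x ∈ basePoints N} → ℂ) →ₗ[ℂ] ℂ :=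
  ∑ b : {x // x ∈ basePoints N}, (width N b.1 : ℂ) • LinearMap.proj b

/-- The cusp values of a weight-`2` form satisfy the residue relation. [folklore] -/
theorem range_cuspValues_le : LinearMap.range (cuspValues N) ≤ LinearMap.ker (widthSum N) := by
  rintro _ ⟨f, rfl⟩
  rw [LinearMap.mem_ker, widthSum, LinearMap.sum_apply]
  simp only [LinearMap.smul_apply, LinearMap.proj_apply, cuspValues, LinearMap.pi_apply,
    cuspValue_apply, smul_eq_mul]
  rw [Finset.sum_coe_sort (basePoints N) (fun b ↦ (width N b : ℂ) * valueAtInfty (cosetSlash N 2 (f : ℍ → ℂ) b))]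
  exact sum_width_mul_valueAtInfty_eq_zero f.2

/-- `dim ker(widthSum) + 1 ≤ #(base points)` (the functional is nonzero). [folklore] -/
theorem finrank_ker_widthSum_lt : Module.finrank ℂ (LinearMap.ker (widthSum N)) + 1 ≤ (basePoints N).card := by
  have hrn := LinearMap.finrank_range_add_finrank_ker (widthSum N)
  rw [Module.finrank_fintype_fun_eq_card, Fintype.card_coe] at hrn
  -- the functional is nonzero: test on the indicator of a base point
  set b₀ : {x // x ∈ basePoints N} := ⟨base N (1 : SL(2, ℤ)), base_mem_basePoints _⟩
  have hne : widthSum N (Pi.single b₀ 1) ≠ 0 := by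
    rw [widthSum, LinearMap.sum_apply]
    simp only [LinearMap.smul_apply, LinearMap.proj_apply, smul_eq_mul]
    rw [Finset.sum_eq_single b₀ (fun b _ hb ↦ by rw [Pi.single_eq_of_ne hb, mul_zero])
      (fun h ↦ absurd (Finset.mem_univ _) h), Pi.single_eq_same, mul_one]
    exact_mod_cast (width_pos N _).ne'
  have hpos : 1 ≤ Module.finrank ℂ (LinearMap.range (widthSum N)) := by
    rw [Nat.one_le_iff_ne_zero, Ne, Submodule.finrank_eq_zero, LinearMap.range_eq_bot]
    intro h0
    exact hne (by rw [h0]; rfl)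
  omega

/-- A `Γ₀(N)`-form all of whose conjugates vanish at `i∞` is a cusp form. [folklore] -/
def cuspFormOfVanishing (f : ℍ → ℂ) (hf : f ∈ gamma0Space N 2)
    (h0 : ∀ γ : SL(2, ℤ), IsZeroAtImInfty (f ∣[(2 : ℤ)] (γ : GL (Fin 2) ℝ))) : CuspForm (Gamma0 N) 2 where
  toFun := f
  slash_action_eq' γ hγ := slash_eq_of_mem_formSpace hf hγ
  holo' := mdifferentiable_of_mem_formSpace hf
  zero_at_cusps' {c} hc := by
    rw [Subgroup.IsArithmetic.isCusp_iff_isCusp_SL2Z] at hc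
    rw [OnePoint.isZeroAt_iff_forall_SL2Z hc]
    intro γ _
    exact h0 γ

/-- Members of `ker(cuspValues)` vanish at every cusp. [folklore] -/
theorem isZeroAtImInfty_of_mem_ker {f : gamma0Space N 2} (hf : f ∈ LinearMap.ker (cuspValues N))
    (γ : SL(2, ℤ)) : IsZeroAtImInfty ((f : ℍ → ℂ) ∣[(2 : ℤ)] (γ : GL (Fin 2) ℝ)) := by
  have hx : ∀ x : 𝕏, valueAtInfty (cosetSlash N 2 (f : ℍ → ℂ) x) = 0 := by
    intro x
    rw [valueAtInfty_cosetSlash_eq_base f.2]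
    have := congr_fun (LinearMap.mem_ker.mp hf) ⟨base N x, base_mem_basePoints x⟩
    exact this
  have heq : (f : ℍ → ℂ) ∣[(2 : ℤ)] (γ : GL (Fin 2) ℝ) = cosetSlash N 2 (f : ℍ → ℂ) ((γ⁻¹ : SL(2, ℤ)) : 𝕏) := by
    rw [cosetSlash_mk (slash_eq_of_mem_gamma0Space f.2), inv_inv]
  rw [heq]
  have := tendsto_cosetSlash f.2 ((γ⁻¹ : SL(2, ℤ)) : 𝕏)
  rwa [hx] at this

variable (N) in
/-- The inclusion `ker(cuspValues) → S₂(Γ₀(N))`. [folklore] -/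
def kerToCuspForm : LinearMap.ker (cuspValues N) →ₗ[ℂ] CuspForm (Gamma0 N) 2 where
  toFun f := cuspFormOfVanishing (f.1 : ℍ → ℂ) f.1.2 (isZeroAtImInfty_of_mem_ker f.2)
  map_add' f g := by ext τ; rfl
  map_smul' c f := by ext τ; rfl

/-- The inclusion is injective. [folklore] -/
theorem kerToCuspForm_injective : Function.Injective (kerToCuspForm N) := by
  intro f g h
  apply Subtype.ext
  apply Subtype.ext
  funext τ
  exact congrArg (fun F : CuspForm (Gamma0 N) 2 ↦ F τ) h

/-- **`dim M₂(Γ₀(N)) + 1 ≤ dim S₂(Γ₀(N)) + ν_∞`** (rank–nullity for the cusp-value map, whose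
image lies in the hyperplane of the residue relation, and whose kernel consists of cusp forms).
[folklore] -/
theorem finrank_gamma0Space_two_le :
    Module.finrank ℂ (gamma0Space N 2) + 1 ≤ Module.finrank ℂ (CuspForm (Gamma0 N) 2) + nuInfty N := by
  haveI : FiniteDimensional ℂ (CuspForm (Gamma0 N) 2) := finiteDimensional_cuspForm_gamma0 N 2
  have hrn := LinearMap.finrank_range_add_finrank_ker (cuspValues N)
  have h1 : Module.finrank ℂ (LinearMap.range (cuspValues N)) ≤ Module.finrank ℂ (LinearMap.ker (widthSum N)) :=
    Submodule.finrank_mono range_cuspValues_le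
  have h2 := finrank_ker_widthSum_lt (N := N)
  have h3 : Module.finrank ℂ (LinearMap.ker (cuspValues N)) ≤ Module.finrank ℂ (CuspForm (Gamma0 N) 2) :=
    LinearMap.finrank_le_finrank_of_injective (kerToCuspForm_injective (N := N))
  rw [card_basePoints] at h2
  omega

end Residue

/-! ### Assembly: `g(X₀(N)) ≤ dim S₂(Γ₀(N))`, the dimension formula, and `Ω^±_f > 0` -/

section Assembly

variable (N : ℕ) [NeZero N]

/-- **Existence of `g(X₀(N))` independent weight-`2` cusp forms on `Γ₀(N)`**, for every `N ≥ 1`,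
by the free-module route (no Riemann surfaces, no Riemann–Roch): with a level-one basis of
`M(Γ₀(N))` of rank `μ`, the elliptic and cusp constraints on the weights give
`dim M₂(Γ₀(N)) ≥ g - 1 + ν_∞`, and the residue relation gives `dim S₂ ≥ dim M₂ - ν_∞ + 1`.
[cite: Gannon2014, Thm. 3.4 and §3.5] -/
theorem genusX0_le_finrank_cuspForm_two : genusX0 N ≤ Module.finrank ℂ (CuspForm (Gamma0 N) 2) := by
  obtain ⟨wt, F, hb, hwt⟩ := exists_isLevelOneBasis_card_eq N
  have hK := totalWeight_eq hb hwt
  have h8 := twelve_mul_genusX0_add_le_card_wt_two hb hwt hK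
  have hq := finrank_gamma0Space_two hb hwt
  have h9 := finrank_gamma0Space_two_le (N := N)
  omega

/-- **The dimension formula `dim S₂(Γ₀(N)) = g(X₀(N))`** for all `N ≥ 1`: discharges the named
fact `finrank_cuspForm_two_eq_genusX0` of `ModularCurve.lean` (the bound `≤` is Manin's,
`ModularCurveGenusBoundProofs`). [cite: DiamondShurman2005, Thm. 3.5.1] -/
theorem finrank_cuspForm_two_eq_genusX0_holds : finrank_cuspForm_two_eq_genusX0 N :=
  (finrank_cuspForm_two_eq_genusX0_iff_le N).mpr (genusX0_le_finrank_cuspForm_two N)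

/-- **The genus formula `12 dim S₂(Γ₀(N)) + 3ν₂ + 4ν₃ + 6ν_∞ = 12 + μ`**: discharges the named
fact `twelve_mul_finrank_cuspForm_two (Γ₀(N))` of `ModularCurveProofs`.
[cite: DiamondShurman2005, Thm. 3.1.1] -/
theorem twelve_mul_finrank_cuspForm_two_gamma0_holds : twelve_mul_finrank_cuspForm_two (Gamma0 N) :=
  (twelve_mul_finrank_cuspForm_two_gamma0_iff N).mpr (finrank_cuspForm_two_eq_genusX0_holds N)

variable {N}

/-- **`Ω⁻_f > 0`** for rational newforms `f ∈ S₂(Γ₀(N))`, every `N ≥ 1`: discharges the named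
fact `IsNewform0.minusPeriod_pos` of `ModularSymbols.lean` (Cremona 1997, §2.8 and §2.10: the
period lattice `Λ_f` is a lattice with `im Λ_f = ℤ·y`, `y > 0`), through the tree's reduction
`IsNewform0.plusPeriod_pos_and_minusPeriod_pos_of_genusX0_le` (Eichler–Shimura lattice from
`dim S₂(Γ₀(N)) = g`) and `conj_mem_periodLattice_holds`. [cite: CremonaAlgorithms1997, §2.8, §2.10] -/
theorem IsNewform0.minusPeriod_pos_holds {f : CuspForm (Gamma0 N) 2} : IsNewform0.minusPeriod_pos (f := f) :=
  (IsNewform0.plusPeriod_pos_and_minusPeriod_pos_of_genusX0_le N (genusX0_le_finrank_cuspForm_two N)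
    conj_mem_periodLattice_holds).2

/-- **`Ω⁺_f > 0`** for rational newforms `f ∈ S₂(Γ₀(N))`, every `N ≥ 1` (same route).
[cite: CremonaAlgorithms1997, §2.8] -/
theorem IsNewform0.plusPeriod_pos_holds {f : CuspForm (Gamma0 N) 2} : IsNewform0.plusPeriod_pos (f := f) :=
  (IsNewform0.plusPeriod_pos_and_minusPeriod_pos_of_genusX0_le N (genusX0_le_finrank_cuspForm_two N)
    conj_mem_periodLattice_holds).1

end Assembly

end Literature.NumberTheory.EllipticCurves.ModularForms
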